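import Mathlib
import Literature.NumberTheory.Sieve.Maynard2016DenseClustersSmoothedSums
import Literature.NumberTheory.Sieve.Maynard2016DenseClustersTestFunction
import HarnessLib

/-!
# Maynard 2016 (*Dense clusters of primes in subsets*), Lemma 8.4: the `r`-fold sums, uniformly in `r`

Topic `Literature/NumberTheory/Sieve`; namespace `Literature.NumberTheory.Sieve.MaynardDense`.
J. Maynard, *Dense clusters of primes in subsets*, Compositio Math. 152 (2016), 1517–1554 = arXiv:1405.2593,
Lemma 8.4 (pp. 16–17 of the arXiv version) and its proof (8.9)–(8.19): for `r ≤ k`, integers `W_1, …, W_r`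
(each a multiple of `∏_{p ≤ 2k²} p`), a multiplicative `g` with `g(p) = p + O(k)`, `G` smooth supported on
`[0, 1]`, `Φ` smooth bounded,
`∑_{e ∈ ℕ^r, (e_i, W_i) = 1} μ²(e)/g(e) · Φ(∑ log e_i/log R) ∏ G(log e_i/log R)
  = Π_g (log R)^r ∫ Φ(∑ t_i) ∏ G(t_i) dt + O(r Ω_G Π_g (log R)^{r−1} log log R ∫ ∏ G)`.

This module PROVES the lemma in explicit form (`lemma84_all`, §4), following the printed induction («We
estimate the sum by applying Lemma 8.3 `r` times to each variable `e_1, …, e_r` in turn»).  §1 is the combinatorial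
skeleton: the `r`-fold sum `rFoldSum` (with a shift `c` in the argument of `Φ`, which is what the induction
produces after integrating out the earlier variables), its weight `rWeight` (`μ²(∏ eᵢ) · 1_{(eᵢ, Wᵢ) = 1 ∀ i} /
∏_{p ∣ ∏ eᵢ} A(p)`, `A(p)` = the printed `g_j(p) = g(p) + n_j(p)` of (8.11)), and the PEEL IDENTITY
`rFoldSum_succ`: singling out the first variable `e_0 = d`, the inner sum over `d` is exactly a smoothed sum of
Lemma 8.3 (`MaynardDense.smoothedSum`) for the multiplicative function (8.13), `γ(p) = 0` for
`p ∣ W_0 ∏_{i ≥ 1} e_i`, `γ(p) = p/(1 + A(p))` otherwise (`MaynardDense.gamma84`, for which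
`μ²(d) g_γ(d) = 1_{(d, W_0 ∏ eᵢ) = 1} μ²(d)/∏_{p ∣ d} A(p)`, `moebius_sq_mul_g_gamma84`), with the one-variable
test function `u ↦ G(u) Φ(c + u + ∑_{i ≥ 1} u_i)`; the weight of the remaining variables after the step is the
one with `A` bumped by `1` at the primes `p ∤ W_0` (`rWeight_bumpA`: the Euler factors `(1 − 1/a_p)`,
`a_p = 1 + A(p)`, of `MaynardDense.cGamma_gamma84_mul` are `A(p)/(A(p) + 1)`), i.e. `g_j → g_{j+1}` of (8.11);
accordingly the constant `Π` is defined by the same recursion (`piRec`, a product of `r` constants `c_γ` of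
Lemma 8.3).  §2 is the case `r = 1` (`lemma84_one` = `MaynardDense.lemma83_gamma84` on the peeled sum); §3 the
orthant-integral calculus of the main terms (`orthInt n G Φ c = ∫_{[0,∞)^n} Φ(c + Σ tᵢ)∏G(tᵢ)`:
`orthInt_zero`, `orthInt_one_eq_pow` = `(∫₀^∞ G)^n`, `abs_orthInt_le`, and the Fubini peel `orthInt_succ`:
`I_{n+1}(Φ, c) = ∫₀^∞ G(u) I_n(Φ, c + u) du`); §4 the analytic induction: Lemma 8.3 applied POINTWISE in the
already-integrated variable (no parametric differentiation: the one-variable test function `u ↦ G(u)Φ(c' + u)`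
is plainly `C¹`, `testFn_bounds`), the constants `c_{γ_m} = c⋆ρ_m` absorbed into the next weight, Fubini, and
the error recursion `1 + δ_{n+1} = (1 + δ_n)(1 + ε)` with `ε = C Λ G_s/(I_G log R)`:
**`|rFoldSum_n − Π_n (log R)^n I_n(Φ, c)| ≤ Π_n (log R)^n I_G^n (Φ₀ + Φ₁)((1 + ε)^n − 1)`** under
`|1 + A(p) − p| + n ≤ K` (printed `g(p) = p + O(k)`), every `W_i` a multiple of the primes `≤ 2K²`,
`G ∈ C¹`, `G ≥ 0`, `G = 0` on `[1,∞)`, `|G| + |G'| ≤ G_s` on `[0,1]` (printed `Ω_G = G_s/∫G`), `Φ ∈ C¹` bounded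
with bounded derivative, and `9 + ∑_{p ∣ M} log p/p ≤ Λ` for the relevant `M ≤ W_i ⌈R⌉^n` (printed
`L ≪ log log R`, see `sum_primeFactors_log_div_le`); for `nε ≤ 1`, `(1+ε)^n − 1 ≤ 2nε` recovers the printed
`O(r Ω_G Π (log R)^{r−1} log log R ∫∏G)`.  §5 identifies `piRec` with the printed Euler product: the partial
products `∏_{p<y} (1 + n(p)/A(p))(1 − 1/p)^r` (`piPartial`, `n(p) = #{i : p ∤ W_i}` = `nW`) converge to
`piRec r W A` (`tendsto_piPartial`; the telescoping `piFactor_succ` of the `r` limits `c_γ`).  §6 discharges the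
`G`- and `Φ`-hypotheses of `lemma84_all` for the profiles of `F` and `F²` (`G = g_k`: `lemma84_hypG_profExt`,
`G = g_k²`: `lemma84_hypG_profExt_sq`, `Φ = ψ`: `lemma84_hypPhi_psi`, `Φ = ψ²`: `lemma84_hypPhi_psi_sq`); §7 the
printed shape of the error, `(1 + ε)^n − 1 ≤ 2nε` for `nε ≤ 1` (`lemma84_all'`).  §8–§9 identify the main-term
integrals of the two applications in §9 of the paper: for `Φ = ψ²`, `G = g_k²` (the `k`-fold sum of `y_r²`,
Proposition 9.1) `orthInt k (g_k²) (ψ²) 0 = I_k(F)` (`orthInt_profExt_sq_psi_sq`), and for the `(k−1)`-fold sum of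
`(y^{(m)}_r)²` (Proposition 9.2 / Lemma 9.3) the profile `H_ψ(c) = ∫₀^∞ ψ(c + u) g_k(u) du` (`Hpsi`:
`∫₀^∞ F(s; s_m := u) du = H_ψ(Σ sⱼ)∏ g_k(sⱼ)`, `inner_F_eq_Hpsi`; `C¹` by dominated differentiation, `contDiff_Hpsi`;
`|H_ψ| ≤ L_k`, `|H_ψ'| ≤ 30 L_k`; `lemma84_hypPhi_Hpsi_sq`) with `orthInt (k−1) (g_k²) (H_ψ²) 0 = J_k(F)`
(`orthInt_profExt_sq_Hpsi_sq`).

DECOUPLED FORMS (`lemma84_all_dec`, `lemma84_all'_dec`, `tendsto_piPartial_dec`): the printed hypotheses are «`W_i` a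
multiple of `∏_{p ≤ 2k²} p`» (a THRESHOLD) and «`g(p) = p + O(k)`», `r ≤ k` (a DEVIATION); these are typed with two
parameters, every prime `p ≤ 2K₀²` dividing each `W_i` (`K₀ ≥ 2`) and `|1 + A(p) − p| + n ≤ K₁` with `K₁ ≤ K₀²`, which is
what the applications in §9 of the paper need (`g(p) = p − ω(p) + O(1)`, `r = k`: `K₀ = k`, `K₁ = 2k + O(1)`); the
single-parameter statements `lemma84_all`, `lemma84_all'`, `tendsto_piPartial` are the case `K₀ = K₁ = K`.  The
decoupling rests on `MaynardDense.hyp_gamma84_dec` (the `(Ω₂)` tail `∑_{p > 2K₀²} K₁ log p/p²` taken over primes).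

Conventions: `e_i` ranges over `1 ≤ e_i < ⌈R⌉₊` (the support of `G(log e_i/log R)`, `G = 0` on `[1, ∞)`, makes
the printed sum over `ℕ^r` this finite one); `u_i = log e_i/log R` (`uOf`).

## References
* J. Maynard, *Dense clusters of primes in subsets*, Compositio Math. 152 (2016), 1517–1554; arXiv:1405.2593,
  Lemma 8.4 with proof, (8.9)–(8.19). [Maynard2016DenseClusters]
-/

noncomputable section

open Finset Filter Real MeasureTheory
open scoped Topology ArithmeticFunction.Moebius

namespace Literature.NumberTheory.Sieve

namespace MaynardDense

/-! ## §1 The `r`-fold sum and the peel identity -/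

/-- `u = log e/log R`. [cite: Maynard2016DenseClusters, proof of Lemma 8.4 (8.11) («u_i = log e_i/log R»)] -/
def uOf (R : ℝ) (e : ℕ) : ℝ := Real.log e / Real.log R

/-- The summation box `1 ≤ e_i < ⌈R⌉₊` (`i < r`). [cite: Maynard2016DenseClusters, Lemma 8.4 (the sum over e ∈ ℕ^r; G supported on [0,1])] -/
def rBox (r : ℕ) (R : ℝ) : Finset (Fin r → ℕ) := Fintype.piFinset fun _ : Fin r => Finset.Ico 1 ⌈R⌉₊

/-- The weight `μ²(e_0⋯e_{r−1}) · 1_{(e_i, W_i) = 1 ∀ i} / ∏_{p ∣ e_0⋯e_{r−1}} A(p)` (printed `μ²(e)/g_j(e)` with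
the coprimality conditions of (8.9)/(8.10); `A(p) = g_j(p)`). [cite: Maynard2016DenseClusters, Lemma 8.4 (8.9)–(8.11)] -/
def rWeight (r : ℕ) (W : Fin r → ℕ) (A : ℕ → ℝ) (e : Fin r → ℕ) : ℝ :=
  if Squarefree (∏ i, e i) ∧ ∀ i, Nat.Coprime (e i) (W i) then
    (∏ p ∈ (∏ i, e i).primeFactors, A p)⁻¹ else 0

/-- The `r`-fold sum (8.9)/(8.10), with a shift `c` in the argument of `Φ`:
`∑_e rWeight(e) · Φ(c + ∑ u_i) ∏ G(u_i)`, `u_i = log e_i/log R`. [cite: Maynard2016DenseClusters, Lemma 8.4 (8.9)–(8.10)] -/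
def rFoldSum (r : ℕ) (W : Fin r → ℕ) (A : ℕ → ℝ) (Φ G : ℝ → ℝ) (R c : ℝ) : ℝ :=
  ∑ e ∈ rBox r R, rWeight r W A e * (Φ (c + ∑ i, uOf R (e i)) * ∏ i, G (uOf R (e i)))

/-- `A` bumped by one at the primes not dividing `W₀`: `g_j(p) + n_j(p) → g(p) + n_{j+1}(p)` of (8.11).
[cite: Maynard2016DenseClusters, proof of Lemma 8.4 (8.11)] -/
def bumpA (W₀ : ℕ) (A : ℕ → ℝ) (p : ℕ) : ℝ := if p ∣ W₀ then A p else A p + 1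

/-- The constant `Π` of Lemma 8.4, by the recursion of the proof: `Π_0 = 1`,
`Π_{r+1}(W, A) = c_γ(W_0, 1 + A) · Π_r(W_1.., bumpA W_0 A)` (`c_γ` the constant of Lemma 8.3 for the `γ` of (8.13)).
[cite: Maynard2016DenseClusters, Lemma 8.4 (Π_g) with proof (8.11) (the constants c_j)] -/
def piRec : (r : ℕ) → (Fin r → ℕ) → (ℕ → ℝ) → ℝ
  | 0, _, _ => 1
  | r + 1, W, A => GGPY.cGamma (gamma84 (W 0) fun p => 1 + A p) * piRec r (Fin.tail W) (bumpA (W 0) A)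

/-- `rBox 0 R = {Fin.elim0}`. [cite: Maynard2016DenseClusters, proof of Lemma 8.4 («(8.10) clearly holds when j = 0»)] -/
theorem rBox_zero (R : ℝ) : rBox 0 R = {fun i => i.elim0} :=
  Finset.eq_singleton_iff_unique_mem.2 ⟨Fintype.mem_piFinset.2 fun i => i.elim0,
    fun _ _ => funext fun i => i.elim0⟩

/-- The `0`-fold weight is `1`. [cite: Maynard2016DenseClusters, proof of Lemma 8.4 («(8.10) clearly holds when j = 0»)] -/
theorem rWeight_zero (W : Fin 0 → ℕ) (A : ℕ → ℝ) (e : Fin 0 → ℕ) : rWeight 0 W A e = 1 := by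
  unfold rWeight; simp

/-- The `0`-fold sum is `Φ(c)`. [cite: Maynard2016DenseClusters, proof of Lemma 8.4 («(8.10) clearly holds when j = 0»)] -/
theorem rFoldSum_zero (W : Fin 0 → ℕ) (A : ℕ → ℝ) (Φ G : ℝ → ℝ) (R c : ℝ) :
    rFoldSum 0 W A Φ G R c = Φ c := by
  unfold rFoldSum
  rw [rBox_zero, Finset.sum_singleton, rWeight_zero]
  simp

/-- Membership in the box, first variable singled out. [cite: Maynard2016DenseClusters, proof of Lemma 8.4 (8.10)] -/
theorem cons_mem_rBox_iff {n : ℕ} {R : ℝ} (d : ℕ) (m : Fin n → ℕ) :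
    (Fin.cons d m : Fin (n + 1) → ℕ) ∈ rBox (n + 1) R ↔ d ∈ Finset.Ico 1 ⌈R⌉₊ ∧ m ∈ rBox n R := by
  simp only [rBox, Fintype.mem_piFinset, Fin.forall_fin_succ, Fin.cons_zero, Fin.cons_succ]

/-- `μ²(d) g_γ(d)` for the `γ` of (8.13) with `a_p = 1 + A(p)`, `A(p) ≠ 0` at the primes of `d`:
`= μ²(d) 1_{(d, M) = 1} / ∏_{p ∣ d} A(p)` (printed: `g_γ(p) = γ(p)/(p − γ(p)) = 1/g_j(p)`).
[cite: Maynard2016DenseClusters, proof of Lemma 8.4 (8.13)] -/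
theorem moebius_sq_mul_g_gamma84 {M : ℕ} {A : ℕ → ℝ} {d : ℕ} (hd : d ≠ 0)
    (hA : ∀ p ∈ d.primeFactors, A p + 1 ≠ 0) :
    ((μ d : ℤ) : ℝ) ^ 2 * GGPY.g (gamma84 M fun p => 1 + A p) d =
      if Squarefree d ∧ Nat.Coprime d M then (∏ p ∈ d.primeFactors, A p)⁻¹ else 0 := by
  by_cases hsq : Squarefree d
  · have hμ : ((μ d : ℤ) : ℝ) ^ 2 = 1 := by
      have h1 := ArithmeticFunction.abs_moebius_eq_one_of_squarefree hsq
      rw [← sq_abs, ← Int.cast_abs, h1]; simp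
    rw [hμ, one_mul]
    unfold GGPY.g
    by_cases hcop : Nat.Coprime d M
    · rw [if_pos ⟨hsq, hcop⟩, ← Finset.prod_inv_distrib]
      refine Finset.prod_congr rfl fun p hp => ?_
      have hpr := Nat.prime_of_mem_primeFactors hp
      have hpd := Nat.dvd_of_mem_primeFactors hp
      have hpM : ¬p ∣ M := fun h => hpr.not_dvd_one (by
        have := Nat.dvd_gcd hpd h
        rwa [hcop.gcd_eq_one] at this)
      have hp0 : (p : ℝ) ≠ 0 := by exact_mod_cast hpr.ne_zero
      have ha := hA p hp
      rw [gamma84_of_not_dvd _ hpM]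
      have h1 : (1 : ℝ) + A p ≠ 0 := by rwa [add_comm]
      by_cases ha0 : A p = 0
      · rw [ha0]; simp
      · field_simp
        rw [add_sub_cancel_left, div_self ha0]
    · rw [if_neg (fun h => hcop h.2)]
      -- some prime of `d` divides `M`: its factor vanishes
      have : ∃ p ∈ d.primeFactors, p ∣ M := by
        by_contra hne
        push Not at hne
        exact hcop (Nat.coprime_of_dvd fun p hp hpd hpM =>
          hne p (Nat.mem_primeFactors.2 ⟨hp, hpd, hd⟩) hpM)
      obtain ⟨p, hp, hpM⟩ := this
      exact Finset.prod_eq_zero hp (by rw [gamma84_of_dvd _ hpM, zero_div])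
  · rw [if_neg (fun h => hsq h.1), ArithmeticFunction.moebius_eq_zero_of_not_squarefree hsq]
    simp

/-- The weight with the first variable singled out:
`rWeight_{n+1}(W, A)(d, m) = 1_{μ²(d) = 1, (d, W_0 ∏ mᵢ) = 1}/∏_{p ∣ d} A(p) · rWeight_n(W_1.., A)(m)`.
[cite: Maynard2016DenseClusters, proof of Lemma 8.4 (8.10), (8.13) (γ(p) = 0 for p ∣ W_{j+1} ∏ e_i)] -/
theorem rWeight_cons {n : ℕ} (W : Fin (n + 1) → ℕ) (A : ℕ → ℝ) (d : ℕ) (m : Fin n → ℕ) :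
    rWeight (n + 1) W A (Fin.cons d m) =
      (if Squarefree d ∧ Nat.Coprime d (W 0 * ∏ i, m i) then (∏ p ∈ d.primeFactors, A p)⁻¹ else 0) *
        rWeight n (Fin.tail W) A m := by
  unfold rWeight
  rw [Fin.prod_univ_succ]
  simp only [Fin.cons_zero, Fin.cons_succ, Fin.forall_fin_succ, Fin.tail]
  by_cases h1 : Squarefree d ∧ Nat.Coprime d (W 0 * ∏ i, m i)
  · by_cases h2 : Squarefree (∏ i, m i) ∧ ∀ i : Fin n, Nat.Coprime (m i) (W i.succ)
    · have hcop : Nat.Coprime d (∏ i, m i) := (Nat.coprime_mul_iff_right.1 h1.2).2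
      rw [if_pos h1, if_pos h2, if_pos ⟨Nat.squarefree_mul_iff.2 ⟨hcop, h1.1, h2.1⟩,
        (Nat.coprime_mul_iff_right.1 h1.2).1, h2.2⟩, hcop.primeFactors_mul,
        Finset.prod_union hcop.disjoint_primeFactors, mul_inv]
    · rw [if_pos h1, if_neg h2, mul_zero, if_neg]
      rintro ⟨hsq, -, hm⟩
      exact h2 ⟨(Nat.squarefree_mul_iff.1 hsq).2.2, hm⟩
  · rw [if_neg h1, zero_mul, if_neg]
    rintro ⟨hsq, hd, hm⟩
    have := Nat.squarefree_mul_iff.1 hsq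
    exact h1 ⟨this.2.1, Nat.coprime_mul_iff_right.2 ⟨hd, this.1⟩⟩

/-- After the step the remaining weight has `A` bumped at the primes `p ∤ W_0`: for `m` in the support of
`rWeight_n(W', A)` (so `∏ mᵢ` squarefree),
`rWeight_n(W', A)(m) · ∏_{p ∣ ∏ mᵢ, p ∤ W_0} A(p)/(A(p) + 1) = rWeight_n(W', bumpA W_0 A)(m)`
(the Euler factors `1 − 1/a_p` of `cGamma_gamma84_mul`; `A > 0` at the primes of `∏ mᵢ`).
[cite: Maynard2016DenseClusters, proof of Lemma 8.4 (8.11) (g_j → g_{j+1}, c_j → c_{j+1})] -/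
theorem rWeight_bumpA {n : ℕ} (W' : Fin n → ℕ) (W₀ : ℕ) {A : ℕ → ℝ} (m : Fin n → ℕ)
    (hA : ∀ p ∈ (∏ i, m i).primeFactors, 0 < A p) :
    rWeight n W' A m * ∏ p ∈ (∏ i, m i).primeFactors.filter (fun p => ¬p ∣ W₀), (1 - 1 / (1 + A p)) =
      rWeight n W' (bumpA W₀ A) m := by
  unfold rWeight
  split_ifs with h
  · rw [Finset.prod_filter, ← Finset.prod_inv_distrib, ← Finset.prod_inv_distrib, ← Finset.prod_mul_distrib]
    refine Finset.prod_congr rfl fun p hp => ?_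
    have ha := hA p hp
    have ha0 : A p ≠ 0 := ha.ne'
    have ha1 : 1 + A p ≠ 0 := by linarith
    unfold bumpA
    split_ifs with hpW
    · rw [mul_one]
    · field_simp
      ring
  · rw [zero_mul]

/-- **The peel identity** (the induction step of (8.10) before any estimate): singling out `e_0 = d`,
`rFoldSum_{n+1}(W, A, Φ, G, R, c) = ∑_m rWeight_n(W_1.., A)(m) ∏_{i≥1} G(u_i) ·
  ∑_{d < R} μ²(d) g_γ(d) G(u_d) Φ(c + u_d + ∑_{i≥1} u_i)`, the inner sum being `MaynardDense.smoothedSum` for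
the `γ` of (8.13) (`M = W_0 ∏_{i≥1} mᵢ`, `a_p = 1 + A(p)`) and the one-variable test function
`u ↦ G(u) Φ(c + u + ∑_{i≥1} u_i)` (`A(p) + 1 ≠ 0` at all primes).
[cite: Maynard2016DenseClusters, proof of Lemma 8.4 (8.10), (8.13), (8.15)] -/
theorem rFoldSum_succ {n : ℕ} (W : Fin (n + 1) → ℕ) {A : ℕ → ℝ} (hA : ∀ p : ℕ, p.Prime → A p + 1 ≠ 0)
    (Φ G : ℝ → ℝ) (R c : ℝ) :
    rFoldSum (n + 1) W A Φ G R c =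
      ∑ m ∈ rBox n R, rWeight n (Fin.tail W) A m * (∏ i, G (uOf R (m i))) *
        smoothedSum (gamma84 (W 0 * ∏ i, m i) fun p => 1 + A p)
          (fun u => G u * Φ (c + u + ∑ i, uOf R (m i))) R := by
  unfold rFoldSum smoothedSum
  -- re-index the box by `(d, m) ↦ Fin.cons d m`
  have hreidx : ∑ e ∈ rBox (n + 1) R, rWeight (n + 1) W A e *
        (Φ (c + ∑ i, uOf R (e i)) * ∏ i, G (uOf R (e i))) =
      ∑ q ∈ Finset.Ico 1 ⌈R⌉₊ ×ˢ rBox n R, rWeight (n + 1) W A (Fin.cons q.1 q.2) *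
        (Φ (c + ∑ i, uOf R ((Fin.cons q.1 q.2 : Fin (n + 1) → ℕ) i)) *
          ∏ i, G (uOf R ((Fin.cons q.1 q.2 : Fin (n + 1) → ℕ) i))) := by
    refine Finset.sum_equiv (Fin.consEquiv fun _ : Fin (n + 1) => ℕ).symm (fun e => ?_) (fun e _ => ?_)
    · rw [Finset.mem_product]
      simp only [Fin.consEquiv_symm_apply]
      rw [← cons_mem_rBox_iff (R := R) (e 0) (Fin.tail e), Fin.cons_self_tail]
    · simp only [Fin.consEquiv_symm_apply, Fin.cons_self_tail]
  rw [hreidx, Finset.sum_product, Finset.sum_comm]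
  refine Finset.sum_congr rfl fun m _ => ?_
  rw [Finset.mul_sum]
  refine Finset.sum_congr rfl fun d hd => ?_
  have hd0 : d ≠ 0 := by have := (Finset.mem_Ico.1 hd).1; omega
  rw [rWeight_cons, Fin.sum_univ_succ, Fin.prod_univ_succ]
  simp only [Fin.cons_zero, Fin.cons_succ]
  rw [moebius_sq_mul_g_gamma84 hd0 (fun p hp => hA p (Nat.prime_of_mem_primeFactors hp))]
  simp only [uOf, ← add_assoc]
  ring

/-! ## §2 The case `r = 1`: Lemma 8.3 for the `γ` of (8.13) -/

/-- `Π_1(W, A) = c_γ(W_0, 1 + A)`. [cite: Maynard2016DenseClusters, proof of Lemma 8.4 (8.11) (c_1)] -/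
theorem piRec_one (W : Fin 1 → ℕ) (A : ℕ → ℝ) :
    piRec 1 W A = GGPY.cGamma (gamma84 (W 0) fun p => 1 + A p) := by
  rw [piRec, piRec, mul_one]

/-- The `1`-fold sum is the smoothed sum of Lemma 8.3 for the `γ` of (8.13) and `u ↦ G(u)Φ(c + u)`.
[cite: Maynard2016DenseClusters, proof of Lemma 8.4 (8.10) (j = 1)] -/
theorem rFoldSum_one (W : Fin 1 → ℕ) {A : ℕ → ℝ} (hA : ∀ p : ℕ, p.Prime → A p + 1 ≠ 0)
    (Φ G : ℝ → ℝ) (R c : ℝ) :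
    rFoldSum 1 W A Φ G R c =
      smoothedSum (gamma84 (W 0) fun p => 1 + A p) (fun u => G u * Φ (c + u)) R := by
  rw [rFoldSum_succ W hA, rBox_zero, Finset.sum_singleton, rWeight_zero]
  simp

/-- The one-variable test function of the step, `u ↦ G(u)Φ(c + u)`, is `C¹` with
`sup_{[0,1]}(|·| + |·'|) ≤ G_s (Φ₀ + Φ₁)` when `|G| + |G'| ≤ G_s` on `[0,1]`, `|Φ| ≤ Φ₀`, `|Φ'| ≤ Φ₁`
(printed (8.17): «from the bounds on Φ, G given in the lemma»). [cite: Maynard2016DenseClusters, proof of Lemma 8.4 (8.17)] -/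
theorem testFn_bounds {G Φ : ℝ → ℝ} (hG : ContDiff ℝ 1 G) (hΦ : ContDiff ℝ 1 Φ) {Gs Φ₀ Φ₁ : ℝ}
    (hGs : ∀ t ∈ Set.Icc (0 : ℝ) 1, |G t| + |deriv G t| ≤ Gs) (hΦ0 : ∀ x, |Φ x| ≤ Φ₀)
    (hΦ1 : ∀ x, |deriv Φ x| ≤ Φ₁) (c : ℝ) :
    ContDiff ℝ 1 (fun u => G u * Φ (c + u)) ∧
      ∀ t ∈ Set.Icc (0 : ℝ) 1,
        |G t * Φ (c + t)| + |deriv (fun u => G u * Φ (c + u)) t| ≤ Gs * (Φ₀ + Φ₁) := by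
  have hsh : ContDiff ℝ 1 (fun u : ℝ => c + u) := contDiff_const.add contDiff_id
  refine ⟨hG.mul (hΦ.comp hsh), fun t ht => ?_⟩
  have hGd : DifferentiableAt ℝ G t := (hG.differentiable (by simp)).differentiableAt
  have hΦd : DifferentiableAt ℝ (fun u => Φ (c + u)) t :=
    ((hΦ.comp hsh).differentiable (by simp)).differentiableAt
  rw [deriv_fun_mul hGd hΦd, deriv_comp_const_add]
  have h1 := hGs t ht
  have h2 := hΦ0 (c + t)
  have h3 := hΦ1 (c + t)
  have hΦ0' : 0 ≤ Φ₀ := (abs_nonneg _).trans h2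
  have hΦ1' : 0 ≤ Φ₁ := (abs_nonneg _).trans h3
  have hG0 : |G t| ≤ Gs := le_trans (le_add_of_nonneg_right (abs_nonneg _)) h1
  calc |G t * Φ (c + t)| + |deriv G t * Φ (c + t) + G t * deriv Φ (c + t)|
      ≤ |G t| * |Φ (c + t)| + (|deriv G t| * |Φ (c + t)| + |G t| * |deriv Φ (c + t)|) := by
        rw [abs_mul]
        refine add_le_add le_rfl ((abs_add_le _ _).trans ?_)
        rw [abs_mul, abs_mul]
    _ ≤ |G t| * Φ₀ + (|deriv G t| * Φ₀ + |G t| * Φ₁) := by gcongr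
    _ = (|G t| + |deriv G t|) * Φ₀ + |G t| * Φ₁ := by ring
    _ ≤ Gs * Φ₀ + Gs * Φ₁ := by gcongr
    _ = Gs * (Φ₀ + Φ₁) := by ring

/-- **Lemma 8.4 for `r = 1`** (the base of the analytic induction = Lemma 8.3 for the `γ` of (8.13)): there is
an absolute `C` such that for `W_0 ≠ 0` a multiple of every prime `p ≤ 2K²` (`K ≥ 2`), `|1 + A(p) − p| ≤ K` at the
primes `p ∤ W_0` (printed `g(p) = p + O(k)`), `A(p) + 1 ≠ 0` at all primes, `G, Φ ∈ C¹(ℝ)` with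
`|G| + |G'| ≤ G_s` on `[0,1]`, `|Φ| ≤ Φ₀`, `|Φ'| ≤ Φ₁`, and `R ≥ 2`:
`|rFoldSum_1 − Π_1 log R ∫₀¹ G(u)Φ(c + u) du| ≤ C Π_1 (9 + ∑_{p ∣ W_0} log p/p) G_s (Φ₀ + Φ₁)`.
[cite: Maynard2016DenseClusters, Lemma 8.4 (r = 1) with proof (8.13)–(8.19)] -/
theorem lemma84_one :
    ∃ C : ℝ, ∀ (W : Fin 1 → ℕ), W 0 ≠ 0 → ∀ (K : ℝ), 2 ≤ K → ∀ (A : ℕ → ℝ),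
      (∀ p : ℕ, p.Prime → ¬p ∣ W 0 → |1 + A p - p| ≤ K) →
      (∀ p : ℕ, p.Prime → (p : ℝ) ≤ 2 * K ^ 2 → p ∣ W 0) →
      (∀ p : ℕ, p.Prime → A p + 1 ≠ 0) →
      ∀ (G Φ : ℝ → ℝ), ContDiff ℝ 1 G → ContDiff ℝ 1 Φ →
      ∀ (Gs Φ₀ Φ₁ : ℝ), (∀ t ∈ Set.Icc (0 : ℝ) 1, |G t| + |deriv G t| ≤ Gs) →
        (∀ x, |Φ x| ≤ Φ₀) → (∀ x, |deriv Φ x| ≤ Φ₁) →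
      ∀ (R c : ℝ), 2 ≤ R →
        |rFoldSum 1 W A Φ G R c -
            piRec 1 W A * Real.log R * ∫ u in (0 : ℝ)..1, G u * Φ (c + u)| ≤
          C * piRec 1 W A * (9 + ∑ p ∈ (W 0).primeFactors, Real.log p / p) * (Gs * (Φ₀ + Φ₁)) := by
  obtain ⟨C, hC⟩ := lemma83_gamma84
  refine ⟨C, fun W hW K hK A hAK hsmall hA1 G Φ hG hΦ Gs Φ₀ Φ₁ hGs hΦ0 hΦ1 R c hR => ?_⟩
  obtain ⟨hcd, hGt⟩ := testFn_bounds hG hΦ hGs hΦ0 hΦ1 c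
  have h := hC (W 0) hW K hK (fun p => 1 + A p) (fun p hp hpW => hAK p hp hpW) hsmall _ hcd _ hGt R hR
  rw [rFoldSum_one W hA1, piRec_one]
  exact h

/-! ## §3 The orthant integrals of the main term: `I_n(Φ, c) = ∫_{[0,∞)^n} Φ(c + Σ tᵢ) ∏ G(tᵢ) dt` -/

/-- The main-term integral of (8.9)/(8.10) with shift `c`: `I_n(Φ, c) = ∫_{[0,∞)^n} Φ(c + Σᵢ tᵢ) ∏ᵢ G(tᵢ) dt`.
[cite: Maynard2016DenseClusters, Lemma 8.4 (the integral ∫ Φ(Σ tᵢ) ∏ G(tᵢ) dtᵢ) and (8.10)] -/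
def orthInt (n : ℕ) (G Φ : ℝ → ℝ) (c : ℝ) : ℝ :=
  ∫ t in orthant n, Φ (c + ∑ i, t i) * ∏ i, G (t i)

/-- Off the orthant some coordinate is negative and the cut-off product vanishes:
`1_{[0,∞)^n}(t) · X(t) ∏ G(tᵢ) = X(t) ∏ (1_{[0,∞)} G)(tᵢ)`. [cite: Maynard2016DenseClusters, proof of Lemma 8.4 (8.10)] -/
theorem indicator_orthant_mul_prod (n : ℕ) (G : ℝ → ℝ) (X : (Fin n → ℝ) → ℝ) (t : Fin n → ℝ) :
    (orthant n).indicator (fun t => X t * ∏ i, G (t i)) t = X t * ∏ i, (Set.Ici (0 : ℝ)).indicator G (t i) := by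
  by_cases ht : t ∈ orthant n
  · rw [Set.indicator_of_mem ht]
    congr 1
    exact Finset.prod_congr rfl fun i _ => by
      rw [Set.indicator_of_mem (Set.mem_Ici.2 (mem_orthant.1 ht i))]
  · rw [Set.indicator_of_notMem ht]
    obtain ⟨j, hj⟩ : ∃ j, t j < 0 := by
      have h := ht; rw [mem_orthant] at h; simpa only [not_forall, not_le] using h
    have hj0 : (Set.Ici (0 : ℝ)).indicator G (t j) = 0 :=
      Set.indicator_of_notMem (fun h => not_le.2 hj (Set.mem_Ici.1 h)) _
    rw [Finset.prod_eq_zero (Finset.mem_univ j) hj0, mul_zero]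

/-- `∏ᵢ (1_{[0,∞)}G)(tᵢ)` is integrable when `1_{[0,∞)}G` is. [cite: Maynard2016DenseClusters, proof of Lemma 8.4 (8.10)] -/
theorem integrable_prod_indicator {G : ℝ → ℝ} (hGi : Integrable ((Set.Ici (0 : ℝ)).indicator G)) (n : ℕ) :
    Integrable fun t : Fin n → ℝ => ∏ i, (Set.Ici (0 : ℝ)).indicator G (t i) :=
  Integrable.fintype_prod (f := fun _ => (Set.Ici (0 : ℝ)).indicator G) fun _ => hGi

/-- `I_n(Φ, c)` as an integral over the whole space. [cite: Maynard2016DenseClusters, proof of Lemma 8.4 (8.10)] -/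
theorem orthInt_eq_integral (n : ℕ) (G Φ : ℝ → ℝ) (c : ℝ) :
    orthInt n G Φ c = ∫ t : Fin n → ℝ, Φ (c + ∑ i, t i) * ∏ i, (Set.Ici (0 : ℝ)).indicator G (t i) := by
  unfold orthInt
  rw [← integral_indicator (measurableSet_orthant n)]
  congr 1
  funext t
  exact indicator_orthant_mul_prod n G _ t

/-- `I_n(1, c) = (∫₀^∞ G)^n` (Fubini). [cite: Maynard2016DenseClusters, Lemma 8.4 (the error-term integral ∫ ∏ G(tᵢ) dtᵢ)] -/
theorem orthInt_one_eq_pow (n : ℕ) (G : ℝ → ℝ) (c : ℝ) :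
    orthInt n G (fun _ => 1) c = (∫ u in Set.Ici (0 : ℝ), G u) ^ n := by
  rw [orthInt_eq_integral]
  simp only [one_mul]
  rw [integral_fintype_prod_volume_eq_pow ((Set.Ici (0 : ℝ)).indicator G), Fintype.card_fin,
    integral_indicator measurableSet_Ici]

/-- `I_0(Φ, c) = Φ(c)`. [cite: Maynard2016DenseClusters, proof of Lemma 8.4 («(8.10) clearly holds when j = 0»)] -/
theorem orthInt_zero (G Φ : ℝ → ℝ) (c : ℝ) : orthInt 0 G Φ c = Φ c := by
  rw [orthInt_eq_integral]
  have : (fun t : Fin 0 → ℝ => Φ (c + ∑ i, t i) * ∏ i, (Set.Ici (0 : ℝ)).indicator G (t i)) =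
      fun t => Φ c * ∏ i, (Set.Ici (0 : ℝ)).indicator G (t i) := by
    funext t; simp
  rw [this, integral_const_mul, integral_fintype_prod_volume_eq_pow, Fintype.card_fin, pow_zero, mul_one]

/-- The pointwise bound `|Φ(c + Σ tᵢ) ∏ (1_{[0,∞)}G)(tᵢ)| ≤ Φ₀ ∏ (1_{[0,∞)}G)(tᵢ)` (`G ≥ 0`, `|Φ| ≤ Φ₀`).
[cite: Maynard2016DenseClusters, proof of Lemma 8.4 («Φ(t) ≪ 1»)] -/
theorem norm_integrand_le {G Φ : ℝ → ℝ} (hG0 : ∀ t, 0 ≤ G t) {Φ₀ : ℝ} (hΦ0 : ∀ x, |Φ x| ≤ Φ₀)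
    (n : ℕ) (c : ℝ) (t : Fin n → ℝ) :
    ‖Φ (c + ∑ i, t i) * ∏ i, (Set.Ici (0 : ℝ)).indicator G (t i)‖ ≤
      Φ₀ * ∏ i, (Set.Ici (0 : ℝ)).indicator G (t i) := by
  have hP : 0 ≤ ∏ i, (Set.Ici (0 : ℝ)).indicator G (t i) :=
    Finset.prod_nonneg fun i _ => Set.indicator_nonneg (fun x _ => hG0 x) _
  rw [Real.norm_eq_abs, abs_mul, abs_of_nonneg hP]
  exact mul_le_mul_of_nonneg_right (hΦ0 _) hP

/-- `|I_n(Φ, c)| ≤ Φ₀ (∫₀^∞ G)^n`. [cite: Maynard2016DenseClusters, proof of Lemma 8.4 («Φ(t) ≪ 1»)] -/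
theorem abs_orthInt_le {G Φ : ℝ → ℝ} (hG0 : ∀ t, 0 ≤ G t) (hGi : Integrable ((Set.Ici (0 : ℝ)).indicator G))
    {Φ₀ : ℝ} (hΦ0 : ∀ x, |Φ x| ≤ Φ₀) (n : ℕ) (c : ℝ) :
    |orthInt n G Φ c| ≤ Φ₀ * (∫ u in Set.Ici (0 : ℝ), G u) ^ n := by
  have h := norm_integral_le_of_norm_le ((integrable_prod_indicator hGi n).const_mul Φ₀)
    (ae_of_all _ (norm_integrand_le hG0 hΦ0 n c))
  rw [Real.norm_eq_abs, integral_const_mul, ← orthInt_eq_integral,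
    integral_fintype_prod_volume_eq_pow ((Set.Ici (0 : ℝ)).indicator G), Fintype.card_fin,
    integral_indicator measurableSet_Ici] at h
  exact h

/-- **Peeling the first coordinate off the main-term integral** (Fubini on `[0,∞) × [0,∞)^n`): for measurable
`G ≥ 0` with `1_{[0,∞)}G` integrable and measurable bounded `Φ`,
`I_{n+1}(Φ, c) = ∫₀^∞ G(u) I_n(Φ, c + u) du`, the integrand being integrable.
[cite: Maynard2016DenseClusters, proof of Lemma 8.4 (8.15)/(8.18) (the integral of G₁)] -/
theorem orthInt_succ {G Φ : ℝ → ℝ} (hGm : Measurable G) (hG0 : ∀ t, 0 ≤ G t)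
    (hGi : Integrable ((Set.Ici (0 : ℝ)).indicator G)) (hΦm : Measurable Φ) {Φ₀ : ℝ}
    (hΦ0 : ∀ x, |Φ x| ≤ Φ₀) (n : ℕ) (c : ℝ) :
    Integrable ((Set.Ici (0 : ℝ)).indicator fun u => G u * orthInt n G Φ (c + u)) ∧
      orthInt (n + 1) G Φ c = ∫ u in Set.Ici (0 : ℝ), G u * orthInt n G Φ (c + u) := by
  set Gc : ℝ → ℝ := (Set.Ici (0 : ℝ)).indicator G with hGc
  have hGcm : Measurable Gc := hGm.indicator measurableSet_Ici
  -- the integrand on the whole space and its integrability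
  set H : (Fin (n + 1) → ℝ) → ℝ := fun t => Φ (c + ∑ i, t i) * ∏ i, Gc (t i) with hH
  have hHm : Measurable H :=
    (hΦm.comp (measurable_const.add (Finset.measurable_sum _ fun i _ => measurable_pi_apply i))).mul
      (Finset.measurable_prod _ fun i _ => hGcm.comp (measurable_pi_apply i))
  have hHi : Integrable H :=
    Integrable.mono' ((integrable_prod_indicator hGi (n + 1)).const_mul Φ₀) hHm.aestronglyMeasurable
      (ae_of_all _ (norm_integrand_le hG0 hΦ0 (n + 1) c))
  set e := MeasurableEquiv.piFinSuccAbove (fun _ : Fin (n + 1) => ℝ) 0 with he_def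
  have he : MeasurePreserving e.symm volume volume :=
    (volume_preserving_piFinSuccAbove (fun _ : Fin (n + 1) => ℝ) 0).symm
  have he_apply : ∀ p : ℝ × (Fin n → ℝ), e.symm p = Fin.insertNth 0 p.1 p.2 := fun p => by
    rw [he_def, MeasurableEquiv.piFinSuccAbove_symm_apply]; rfl
  -- `H` on the split coordinates
  set f : ℝ × (Fin n → ℝ) → ℝ := fun p => Gc p.1 * (Φ (c + p.1 + ∑ j, p.2 j) * ∏ j, Gc (p.2 j)) with hf
  have hpt : ∀ p : ℝ × (Fin n → ℝ), H (e.symm p) = f p := by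
    rintro ⟨u, s⟩
    rw [he_apply, hH, hf]
    dsimp only
    rw [Fin.sum_univ_succAbove _ 0, Fin.prod_univ_succAbove _ 0]
    simp only [Fin.insertNth_apply_same, Fin.insertNth_apply_succAbove]
    rw [← add_assoc]
    ring
  have hfi : Integrable f (volume.prod volume) := by
    have h1 : Integrable (H ∘ e.symm) volume := he.integrable_comp_of_integrable hHi
    have h2 : H ∘ e.symm = f := funext hpt
    rw [h2] at h1
    rwa [Measure.volume_eq_prod] at h1
  -- the inner integral is `Gc u · I_n(Φ, c + u)`
  have hinner : ∀ u : ℝ, ∫ s, f (u, s) = Gc u * orthInt n G Φ (c + u) := fun u => by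
    rw [hf]
    dsimp only
    rw [integral_const_mul, orthInt_eq_integral]
  have hind : (fun u => Gc u * orthInt n G Φ (c + u)) =
      (Set.Ici (0 : ℝ)).indicator fun u => G u * orthInt n G Φ (c + u) := by
    funext u
    rw [hGc]
    by_cases hu : u ∈ Set.Ici (0 : ℝ)
    · rw [Set.indicator_of_mem hu, Set.indicator_of_mem hu]
    · rw [Set.indicator_of_notMem hu, Set.indicator_of_notMem hu, zero_mul]
  refine ⟨?_, ?_⟩
  · have h := hfi.integral_prod_left
    have h' : (fun u => ∫ s, f (u, s)) = fun u => Gc u * orthInt n G Φ (c + u) := funext hinner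
    rw [h', hind] at h
    exact h
  · calc orthInt (n + 1) G Φ c = ∫ t, H t := by rw [orthInt_eq_integral]
      _ = ∫ p, H (e.symm p) := (he.integral_comp' _).symm
      _ = ∫ p, f p := integral_congr_ae (ae_of_all _ hpt)
      _ = ∫ u, ∫ s, f (u, s) := by rw [Measure.volume_eq_prod]; exact integral_prod _ hfi
      _ = ∫ u, Gc u * orthInt n G Φ (c + u) := integral_congr_ae (ae_of_all _ hinner)
      _ = ∫ u in Set.Ici (0 : ℝ), G u * orthInt n G Φ (c + u) := by
          rw [hind, integral_indicator measurableSet_Ici]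

/-! ## §4 Lemma 8.4 for all `r`: the analytic induction -/

/-- `∫₀¹ f = ∫₀^∞ f` for `f` vanishing on `[1, ∞)`. [cite: Maynard2016DenseClusters, Lemma 8.4 («G supported on [0,1]»)] -/
theorem intervalIntegral_eq_setIntegral_Ici {f : ℝ → ℝ} (hf : ∀ x, 1 ≤ x → f x = 0) :
    ∫ x in (0 : ℝ)..1, f x = ∫ x in Set.Ici (0 : ℝ), f x := by
  rw [intervalIntegral.integral_of_le zero_le_one, ← integral_Icc_eq_integral_Ioc]
  refine (setIntegral_eq_of_subset_of_forall_sdiff_eq_zero measurableSet_Ici Set.Icc_subset_Ici_self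
    fun x hx => hf x ?_).symm
  by_contra h
  exact hx.2 ⟨Set.mem_Ici.1 hx.1, le_of_lt (not_le.1 h)⟩

/-- The weight is non-negative when `A > 0` at primes. [cite: Maynard2016DenseClusters, proof of Lemma 8.4 (8.11)] -/
theorem rWeight_nonneg {n : ℕ} (W : Fin n → ℕ) {A : ℕ → ℝ} (hA : ∀ p : ℕ, p.Prime → 0 < A p)
    (e : Fin n → ℕ) : 0 ≤ rWeight n W A e := by
  unfold rWeight
  split_ifs
  · exact inv_nonneg.2 (Finset.prod_nonneg fun p hp => (hA p (Nat.prime_of_mem_primeFactors hp)).le)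
  · exact le_rfl

/-- `bumpA` keeps positivity. [cite: Maynard2016DenseClusters, proof of Lemma 8.4 (8.11)] -/
theorem bumpA_pos {W₀ : ℕ} {A : ℕ → ℝ} {p : ℕ} (h : 0 < A p) : 0 < bumpA W₀ A p := by
  unfold bumpA; split_ifs <;> linarith

/-- `|1 + A'(p) − p| ≤ |1 + A(p) − p| + 1` for `A' = bumpA W₀ A`. [cite: Maynard2016DenseClusters, proof of Lemma 8.4 (8.13) («= 1 + O(k/p)»)] -/
theorem abs_bumpA_le (W₀ : ℕ) (A : ℕ → ℝ) (p : ℕ) :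
    |1 + bumpA W₀ A p - p| ≤ |1 + A p - p| + 1 := by
  unfold bumpA
  split_ifs
  · linarith [abs_nonneg (1 + A p - p)]
  · calc |1 + (A p + 1) - (p : ℝ)| = |(1 + A p - p) + 1| := by ring_nf
      _ ≤ |1 + A p - p| + |(1 : ℝ)| := abs_add_le _ _
      _ = |1 + A p - p| + 1 := by rw [abs_one]

/-- For `m` in the box: `∏ mᵢ ≠ 0` and `∏ mᵢ ≤ ⌈R⌉₊^n`. [cite: Maynard2016DenseClusters, proof of Lemma 8.4 (8.14) («an integer which is ≪ R^{O(k²)}»)] -/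
theorem prod_of_mem_rBox {n : ℕ} {R : ℝ} {m : Fin n → ℕ} (hm : m ∈ rBox n R) :
    (∏ i, m i) ≠ 0 ∧ ((∏ i, m i : ℕ) : ℝ) ≤ (⌈R⌉₊ : ℝ) ^ n := by
  rw [rBox, Fintype.mem_piFinset] at hm
  refine ⟨Finset.prod_ne_zero_iff.2 fun i _ => by have := (Finset.mem_Ico.1 (hm i)).1; omega, ?_⟩
  have h : (∏ i, m i) ≤ ⌈R⌉₊ ^ n := by
    calc (∏ i, m i) ≤ ⌈R⌉₊ ^ (Finset.univ : Finset (Fin n)).card :=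
          Finset.prod_le_pow_card _ _ _ fun i _ => (Finset.mem_Ico.1 (hm i)).2.le
      _ = ⌈R⌉₊ ^ n := by rw [Finset.card_univ, Fintype.card_fin]
  exact_mod_cast h

set_option maxHeartbeats 400000 in
/-- **Maynard 2016, Lemma 8.4 (all `r`), explicit form — threshold and deviation DECOUPLED.**  There is an
absolute `C ≥ 0` such that for every `n`, `W : Fin n → ℕ` (each `≠ 0` and a multiple of every prime `p ≤ 2K₀²`,
`K₀ ≥ 2`; printed: `W_i` a multiple of `∏_{p ≤ 2k²} p`), `A > 0` at primes with `|1 + A(p) − p| + n ≤ K₁`,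
`K₁ ≤ K₀²` (printed: `g(p) = p + O(k)`, `r ≤ k`; in the applications of §9 of the paper `g(p) = p − ω(p) + O(1)` and
`r = k`, so `K₀ = k`, `K₁ = 2k + O(1) ≤ k²`), `G ∈ C¹` with `G ≥ 0`, `G = 0` on `[1, ∞)`, `|G| + |G'| ≤ G_s` on
`[0,1]`, `∫₀^∞ G = I_G > 0`, `Φ ∈ C¹` with `|Φ| ≤ Φ₀`, `|Φ'| ≤ Φ₁`, `R ≥ 2`, and `9 + ∑_{p ∣ M} log p/p ≤ Λ` for all
`M ≤ Wᵢ ⌈R⌉^n` (printed `L ≪ log log R`):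
`Π_n ≥ 0` and `|rFoldSum_n(W, A, Φ, G, R, c) − Π_n (log R)^n I_n(Φ, c)| ≤ Π_n (log R)^n I_G^n (Φ₀ + Φ₁)((1 + ε)^n − 1)`,
`ε = C Λ G_s/(I_G log R)`.  Proof = the printed induction: peel (`rFoldSum_succ`), Lemma 8.3 pointwise in the
integrated variables (`lemma83_gamma84_dec`, whose `(Ω₂)` check takes the tail `∑_{p>2K₀²} K₁ log p/p²` over primes),
`c_{γ_m} = c⋆ ρ_m` (`cGamma_gamma84_mul`) absorbed into the next weight (`rWeight_bumpA`), Fubini (`orthInt_succ`),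
and the error recursion `1 + δ_{n+1} = (1 + δ_n)(1 + ε)`; `lemma84_all` below is the case `K₀ = K₁ = K`.
[cite: Maynard2016DenseClusters, Lemma 8.4 with proof (8.9)–(8.19)] -/
theorem lemma84_all_dec :
    ∃ C : ℝ, 0 ≤ C ∧ ∀ (n : ℕ) (W : Fin n → ℕ) (K₀ K₁ : ℝ) (A : ℕ → ℝ) (G Φ : ℝ → ℝ)
        (Gs IG Φ₀ Φ₁ Λ R c : ℝ),
      2 ≤ K₀ → K₁ ≤ K₀ ^ 2 → (∀ i, W i ≠ 0) →
      (∀ i, ∀ p : ℕ, p.Prime → (p : ℝ) ≤ 2 * K₀ ^ 2 → p ∣ W i) →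
      (∀ p : ℕ, p.Prime → 0 < A p) → (∀ p : ℕ, p.Prime → |1 + A p - p| + n ≤ K₁) →
      ContDiff ℝ 1 G → (∀ t, 0 ≤ G t) → (∀ t, 1 ≤ t → G t = 0) →
      Integrable ((Set.Ici (0 : ℝ)).indicator G) →
      (∀ t ∈ Set.Icc (0 : ℝ) 1, |G t| + |deriv G t| ≤ Gs) →
      (∫ u in Set.Ici (0 : ℝ), G u) = IG → 0 < IG →
      ContDiff ℝ 1 Φ → (∀ x, |Φ x| ≤ Φ₀) → (∀ x, |deriv Φ x| ≤ Φ₁) → 2 ≤ R →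
      (∀ i, ∀ M : ℕ, M ≠ 0 → (M : ℝ) ≤ (W i : ℝ) * (⌈R⌉₊ : ℝ) ^ n →
          9 + ∑ p ∈ M.primeFactors, Real.log p / p ≤ Λ) →
      0 ≤ piRec n W A ∧
        |rFoldSum n W A Φ G R c - piRec n W A * Real.log R ^ n * orthInt n G Φ c| ≤
          piRec n W A * Real.log R ^ n * IG ^ n * (Φ₀ + Φ₁) *
            ((1 + C * Λ * Gs / (IG * Real.log R)) ^ n - 1) := by
  obtain ⟨C₀, hC₀⟩ := lemma83_gamma84_dec
  refine ⟨max C₀ 0, le_max_right _ _, fun n => ?_⟩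
  set C := max C₀ 0 with hCdef
  have hC0 : 0 ≤ C := le_max_right _ _
  induction n with
  | zero =>
    intro W K₀ K₁ A G Φ Gs IG Φ₀ Φ₁ Λ R c hK₀ hK₁ hW hsm hA hAK hG hG0 hG1 hGi hGs hIG hIGpos hΦ hΦ0 hΦ1 hR hΛ
    refine ⟨by simp [piRec], ?_⟩
    rw [rFoldSum_zero, orthInt_zero]
    simp [piRec]
  | succ n ih =>
    intro W K₀ K₁ A G Φ Gs IG Φ₀ Φ₁ Λ R c hK₀ hK₁ hW hsm hA hAK hG hG0 hG1 hGi hGs hIG hIGpos hΦ hΦ0 hΦ1 hR hΛ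
    -- basic positivity
    have hlogR : 0 < Real.log R := Real.log_pos (by linarith)
    have hceil1 : (1 : ℝ) ≤ (⌈R⌉₊ : ℝ) := by
      have : (1 : ℕ) ≤ ⌈R⌉₊ := Nat.one_le_iff_ne_zero.2 (Nat.pos_iff_ne_zero.1 (Nat.ceil_pos.2 (by linarith)))
      exact_mod_cast this
    have hΦ0nn : 0 ≤ Φ₀ := (abs_nonneg _).trans (hΦ0 0)
    have hΦ1nn : 0 ≤ Φ₁ := (abs_nonneg _).trans (hΦ1 0)
    have hGsnn : 0 ≤ Gs := le_trans (by positivity) (hGs 0 ⟨le_rfl, zero_le_one⟩)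
    have hΛ9 : 9 ≤ Λ := by
      have h := hΛ 0 1 one_ne_zero (by
        have h1 : (1 : ℝ) ≤ W 0 := by exact_mod_cast Nat.one_le_iff_ne_zero.2 (hW 0)
        calc ((1 : ℕ) : ℝ) = 1 * 1 := by norm_num
          _ ≤ (W 0 : ℝ) * (⌈R⌉₊ : ℝ) ^ (n + 1) := mul_le_mul h1 (one_le_pow₀ hceil1) zero_le_one (by linarith))
      simpa using h
    have hΛ0 : 0 ≤ Λ := by linarith
    set ε := C * Λ * Gs / (IG * Real.log R) with hεdef
    have hε0 : 0 ≤ ε := by positivity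
    have hεmul : ε * (IG * Real.log R) = C * Λ * Gs := div_mul_cancel₀ _ (mul_pos hIGpos hlogR).ne'
    -- the level-0 data: γ for `M = W 0`
    have haK : ∀ p : ℕ, p.Prime → ¬p ∣ W 0 → |(fun p => 1 + A p) p - p| ≤ K₁ := fun p hp _ => by
      have h := hAK p hp
      have : (0 : ℝ) ≤ (n + 1 : ℕ) := Nat.cast_nonneg _
      simp only
      push_cast at h
      linarith
    have hsm0 : ∀ p : ℕ, p.Prime → (p : ℝ) ≤ 2 * K₀ ^ 2 → p ∣ W 0 := hsm 0
    obtain ⟨h1γ, -⟩ := hyp_gamma84_dec (hW 0) hK₀ hK₁ haK hsm0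
    have hconv := tendsto_cGammaPartial_gamma84_dec (hW 0) hK₀ hK₁ haK hsm0
    have hcs0 : 0 ≤ GGPY.cGamma (gamma84 (W 0) fun p => 1 + A p) :=
      GGPY.cGamma_nonneg (by norm_num) h1γ hconv
    -- the data for the induction hypothesis: `W' = tail W`, `A' = bumpA (W 0) A`
    have hW' : ∀ i : Fin n, Fin.tail W i ≠ 0 := fun i => hW i.succ
    have hsm' : ∀ i : Fin n, ∀ p : ℕ, p.Prime → (p : ℝ) ≤ 2 * K₀ ^ 2 → p ∣ Fin.tail W i :=
      fun i => hsm i.succ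
    have hA' : ∀ p : ℕ, p.Prime → 0 < bumpA (W 0) A p := fun p hp => bumpA_pos (hA p hp)
    have hAK' : ∀ p : ℕ, p.Prime → |1 + bumpA (W 0) A p - p| + n ≤ K₁ := fun p hp => by
      have h1 := abs_bumpA_le (W 0) A p
      have h2 := hAK p hp
      push_cast at h2
      linarith
    have hΛ' : ∀ i : Fin n, ∀ M : ℕ, M ≠ 0 → (M : ℝ) ≤ (Fin.tail W i : ℝ) * (⌈R⌉₊ : ℝ) ^ n →
        9 + ∑ p ∈ M.primeFactors, Real.log p / p ≤ Λ := fun i M hM hle =>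
      hΛ i.succ M hM (hle.trans (by
        rw [Fin.tail, pow_succ]
        have : (0 : ℝ) ≤ (W i.succ : ℝ) * (⌈R⌉₊ : ℝ) ^ n := by positivity
        nlinarith))
    -- the two instances of the induction hypothesis
    have ihΦ : ∀ u : ℝ, 0 ≤ piRec n (Fin.tail W) (bumpA (W 0) A) ∧
        |rFoldSum n (Fin.tail W) (bumpA (W 0) A) Φ G R (c + u) -
            piRec n (Fin.tail W) (bumpA (W 0) A) * Real.log R ^ n * orthInt n G Φ (c + u)| ≤
          piRec n (Fin.tail W) (bumpA (W 0) A) * Real.log R ^ n * IG ^ n * (Φ₀ + Φ₁) *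
            ((1 + C * Λ * Gs / (IG * Real.log R)) ^ n - 1) := fun u =>
      ih (Fin.tail W) K₀ K₁ (bumpA (W 0) A) G Φ Gs IG Φ₀ Φ₁ Λ R (c + u) hK₀ hK₁ hW' hsm' hA' hAK' hG hG0 hG1
        hGi hGs hIG hIGpos hΦ hΦ0 hΦ1 hR hΛ'
    have ih1 := ih (Fin.tail W) K₀ K₁ (bumpA (W 0) A) G (fun _ => (1 : ℝ)) Gs IG 1 0 Λ R 0 hK₀ hK₁ hW' hsm'
      hA' hAK' hG hG0 hG1 hGi hGs hIG hIGpos contDiff_const (fun _ => by simp) (fun _ => by simp) hR hΛ'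
    rw [orthInt_one_eq_pow, hIG] at ih1
    obtain ⟨hPn0, ih1b⟩ := ih1
    -- abbreviations
    set cs := GGPY.cGamma (gamma84 (W 0) fun p => 1 + A p) with hcsdef
    set Pn := piRec n (Fin.tail W) (bumpA (W 0) A) with hPndef
    set δ := (1 + C * Λ * Gs / (IG * Real.log R)) ^ n - 1 with hδdef
    have hpi : piRec (n + 1) W A = cs * Pn := rfl
    have hδ0 : 0 ≤ δ := by
      rw [hδdef, ← hεdef]; linarith [one_le_pow₀ (show (1 : ℝ) ≤ 1 + ε by linarith) (n := n)]
    refine ⟨by rw [hpi]; exact mul_nonneg hcs0 hPn0, ?_⟩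
    -- per-`m` data
    have hA1 : ∀ p : ℕ, p.Prime → A p + 1 ≠ 0 := fun p hp => (by linarith [hA p hp])
    let U : (Fin n → ℕ) → ℝ := fun m => ∑ i, uOf R (m i)
    let P : (Fin n → ℕ) → ℝ := fun m => ∏ i, G (uOf R (m i))
    let w : (Fin n → ℕ) → ℝ := fun m => rWeight n (Fin.tail W) A m
    let w' : (Fin n → ℕ) → ℝ := fun m => rWeight n (Fin.tail W) (bumpA (W 0) A) m
    let ρ : (Fin n → ℕ) → ℝ := fun m =>
      ∏ p ∈ (∏ i, m i).primeFactors.filter (fun p => ¬p ∣ W 0), (1 - 1 / (1 + A p))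
    let S : (Fin n → ℕ) → ℝ := fun m =>
      smoothedSum (gamma84 (W 0 * ∏ i, m i) fun p => 1 + A p) (fun u => G u * Φ (c + U m + u)) R
    let J : (Fin n → ℕ) → ℝ := fun m => ∫ u in Set.Ici (0 : ℝ), G u * Φ (c + U m + u)
    have hP0 : ∀ m, 0 ≤ P m := fun m => Finset.prod_nonneg fun i _ => hG0 _
    have hw0 : ∀ m, 0 ≤ w m := fun m => rWeight_nonneg _ hA m
    have hw'0 : ∀ m, 0 ≤ w' m := fun m => rWeight_nonneg _ hA' m
    have hρ0 : ∀ m, 0 ≤ ρ m := fun m => Finset.prod_nonneg fun p hp => by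
      have hpr := Nat.prime_of_mem_primeFactors (Finset.mem_filter.1 hp).1
      have := hA p hpr
      rw [sub_nonneg, div_le_one (by linarith)]; linarith
    -- (i) `w ρ = w'`
    have hwρ : ∀ m ∈ rBox n R, w m * ρ m = w' m := fun m hm =>
      rWeight_bumpA (Fin.tail W) (W 0) m fun p hp => hA p (Nat.prime_of_mem_primeFactors hp)
    -- (ii) `c_{γ_m} = cs ρ_m`
    have hcγ : ∀ m ∈ rBox n R, GGPY.cGamma (gamma84 (W 0 * ∏ i, m i) fun p => 1 + A p) = cs * ρ m :=
      fun m hm => (cGamma_gamma84_mul (prod_of_mem_rBox hm).1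
        (fun p hp _ _ => ne_of_gt (show (1 : ℝ) < 1 + A p by linarith [hA p hp])) hconv).2
    -- (iii) Lemma 8.3 for each `m`
    have hS : ∀ m ∈ rBox n R, |S m - cs * ρ m * Real.log R * J m| ≤
        C * (cs * ρ m) * Λ * (Gs * (Φ₀ + Φ₁)) := by
      intro m hm
      obtain ⟨hE, hEle⟩ := prod_of_mem_rBox hm
      have hM : W 0 * ∏ i, m i ≠ 0 := mul_ne_zero (hW 0) hE
      have haKM : ∀ p : ℕ, p.Prime → ¬p ∣ W 0 * ∏ i, m i → |(fun p => 1 + A p) p - p| ≤ K₁ :=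
        fun p hp hpM => haK p hp fun h => hpM (dvd_mul_of_dvd_left h _)
      have hsmM : ∀ p : ℕ, p.Prime → (p : ℝ) ≤ 2 * K₀ ^ 2 → p ∣ W 0 * ∏ i, m i :=
        fun p hp hle => dvd_mul_of_dvd_left (hsm0 p hp hle) _
      obtain ⟨hcd, hGt⟩ := testFn_bounds hG hΦ hGs hΦ0 hΦ1 (c + U m)
      have h := hC₀ _ hM K₀ K₁ hK₀ hK₁ (fun p => 1 + A p) haKM hsmM _ hcd _ hGt R hR
      -- the main-term integral as an integral over `[0, ∞)`
      have hJ : ∫ x in (0 : ℝ)..1, G x * Φ (c + U m + x) = J m :=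
        intervalIntegral_eq_setIntegral_Ici fun x hx => by rw [hG1 x hx, zero_mul]
      rw [hJ, hcγ m hm] at h
      refine h.trans ?_
      -- `C₀ (cs ρ) L G̃max ≤ C (cs ρ) Λ G̃max`
      have hL : 9 + ∑ p ∈ (W 0 * ∏ i, m i).primeFactors, Real.log p / p ≤ Λ :=
        hΛ 0 _ hM (by
          have h1 : ((∏ i, m i : ℕ) : ℝ) ≤ (⌈R⌉₊ : ℝ) ^ (n + 1) := hEle.trans (by
            rw [pow_succ]; nlinarith [pow_nonneg (zero_le_one.trans hceil1) n])
          rw [Nat.cast_mul]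
          exact mul_le_mul_of_nonneg_left h1 (Nat.cast_nonneg _))
      have hL0 : 0 ≤ 9 + ∑ p ∈ (W 0 * ∏ i, m i).primeFactors, Real.log p / p := by
        have : 0 ≤ ∑ p ∈ (W 0 * ∏ i, m i).primeFactors, Real.log p / p :=
          Finset.sum_nonneg fun p hp => by have := (Nat.prime_of_mem_primeFactors hp).pos; positivity
        linarith
      have hGΦ : 0 ≤ Gs * (Φ₀ + Φ₁) := mul_nonneg hGsnn (add_nonneg hΦ0nn hΦ1nn)
      have hX : 0 ≤ cs * ρ m * (Gs * (Φ₀ + Φ₁)) := mul_nonneg (mul_nonneg hcs0 (hρ0 m)) hGΦ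
      calc C₀ * (cs * ρ m) * (9 + ∑ p ∈ (W 0 * ∏ i, m i).primeFactors, Real.log p / p) * (Gs * (Φ₀ + Φ₁))
          ≤ C * (cs * ρ m) * (9 + ∑ p ∈ (W 0 * ∏ i, m i).primeFactors, Real.log p / p) * (Gs * (Φ₀ + Φ₁)) := by
            have : C₀ ≤ C := le_max_left _ _
            have : 0 ≤ cs * ρ m * (9 + ∑ p ∈ (W 0 * ∏ i, m i).primeFactors, Real.log p / p) *
                (Gs * (Φ₀ + Φ₁)) := mul_nonneg (mul_nonneg (mul_nonneg hcs0 (hρ0 m)) hL0) hGΦ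
            nlinarith
        _ ≤ C * (cs * ρ m) * Λ * (Gs * (Φ₀ + Φ₁)) := by
            have h2 : 0 ≤ C * (cs * ρ m) := mul_nonneg hC0 (mul_nonneg hcs0 (hρ0 m))
            have : 0 ≤ C * (cs * ρ m) * (Gs * (Φ₀ + Φ₁)) := mul_nonneg h2 hGΦ
            nlinarith
    -- (iv) the peel identity in the present notation
    have hT : rFoldSum (n + 1) W A Φ G R c = ∑ m ∈ rBox n R, w m * P m * S m := by
      rw [rFoldSum_succ W hA1]
      refine Finset.sum_congr rfl fun m _ => ?_
      have : (fun u => G u * Φ (c + u + ∑ i, uOf R (m i))) = fun u => G u * Φ (c + U m + u) := by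
        funext u; rw [add_right_comm]
      rw [this]
    -- (v) the main sum is an integral of the `n`-fold sum
    have hint_m : ∀ m ∈ rBox n R, IntegrableOn (fun u => G u * Φ (c + U m + u)) (Set.Ici (0 : ℝ)) := by
      intro m _
      have hGI : IntegrableOn G (Set.Ici (0 : ℝ)) := (integrable_indicator_iff measurableSet_Ici).1 hGi
      exact hGI.mul_bdd ((hΦ.continuous.comp (continuous_const.add continuous_id)).aestronglyMeasurable)
        (ae_of_all _ fun u => by rw [Real.norm_eq_abs]; exact hΦ0 _)
    have hmain : ∑ m ∈ rBox n R, w' m * P m * J m =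
        ∫ u in Set.Ici (0 : ℝ), G u * rFoldSum n (Fin.tail W) (bumpA (W 0) A) Φ G R (c + u) := by
      have hrw : ∀ u, G u * rFoldSum n (Fin.tail W) (bumpA (W 0) A) Φ G R (c + u) =
          ∑ m ∈ rBox n R, w' m * P m * (G u * Φ (c + U m + u)) := fun u => by
        unfold rFoldSum
        rw [Finset.mul_sum]
        refine Finset.sum_congr rfl fun m _ => ?_
        simp only [w', P, U]
        rw [show c + u + ∑ i, uOf R (m i) = c + (∑ i, uOf R (m i)) + u by ring]
        ring
      simp_rw [hrw]
      rw [integral_finsetSum _ fun m hm => ((hint_m m hm).const_mul (w' m * P m))]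
      refine Finset.sum_congr rfl fun m _ => ?_
      rw [integral_const_mul]
    -- (vi) the error of Lemma 8.3 summed over `m`
    have hE1 : |∑ m ∈ rBox n R, w m * P m * S m -
        cs * Real.log R * ∑ m ∈ rBox n R, w' m * P m * J m| ≤
        C * cs * Λ * (Gs * (Φ₀ + Φ₁)) * rFoldSum n (Fin.tail W) (bumpA (W 0) A) (fun _ => 1) G R 0 := by
      have hF1 : rFoldSum n (Fin.tail W) (bumpA (W 0) A) (fun _ => 1) G R 0 = ∑ m ∈ rBox n R, w' m * P m := by
        unfold rFoldSum
        exact Finset.sum_congr rfl fun m _ => by simp only [w', P, one_mul]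
      rw [hF1, Finset.mul_sum, Finset.mul_sum, ← Finset.sum_sub_distrib]
      refine (Finset.abs_sum_le_sum_abs _ _).trans (Finset.sum_le_sum fun m hm => ?_)
      have h1 : w m * P m * S m - cs * Real.log R * (w' m * P m * J m) =
          w m * P m * (S m - cs * ρ m * Real.log R * J m) := by
        rw [← hwρ m hm]; ring
      rw [h1, abs_mul, abs_of_nonneg (mul_nonneg (hw0 m) (hP0 m))]
      calc w m * P m * |S m - cs * ρ m * Real.log R * J m|
          ≤ w m * P m * (C * (cs * ρ m) * Λ * (Gs * (Φ₀ + Φ₁))) :=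
            mul_le_mul_of_nonneg_left (hS m hm) (mul_nonneg (hw0 m) (hP0 m))
        _ = C * cs * Λ * (Gs * (Φ₀ + Φ₁)) * (w' m * P m) := by rw [← hwρ m hm]; ring
    -- (vii) the induction hypothesis inside the integral
    have hintR : IntegrableOn (fun u => G u * rFoldSum n (Fin.tail W) (bumpA (W 0) A) Φ G R (c + u))
        (Set.Ici (0 : ℝ)) := by
      have hrw : (fun u => G u * rFoldSum n (Fin.tail W) (bumpA (W 0) A) Φ G R (c + u)) =
          fun u => ∑ m ∈ rBox n R, w' m * P m * (G u * Φ (c + U m + u)) := by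
        funext u
        unfold rFoldSum
        rw [Finset.mul_sum]
        refine Finset.sum_congr rfl fun m _ => ?_
        simp only [w', P, U]
        rw [show c + u + ∑ i, uOf R (m i) = c + (∑ i, uOf R (m i)) + u by ring]
        ring
      rw [hrw]
      exact MeasureTheory.integrable_finsetSum (rBox n R) fun m hm => (hint_m m hm).const_mul (w' m * P m)
    obtain ⟨hintI, hsucc⟩ := orthInt_succ hG.continuous.measurable hG0 hGi hΦ.continuous.measurable hΦ0 n c
    have hintI' : IntegrableOn (fun u => G u * orthInt n G Φ (c + u)) (Set.Ici (0 : ℝ)) :=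
      (integrable_indicator_iff measurableSet_Ici).1 hintI
    set B := Pn * Real.log R ^ n * IG ^ n * (Φ₀ + Φ₁) * δ with hBdef
    have hB0 : 0 ≤ B :=
      mul_nonneg (mul_nonneg (mul_nonneg (mul_nonneg hPn0 (pow_nonneg hlogR.le n))
        (pow_nonneg hIGpos.le n)) (add_nonneg hΦ0nn hΦ1nn)) hδ0
    have hE2 : |(∫ u in Set.Ici (0 : ℝ), G u * rFoldSum n (Fin.tail W) (bumpA (W 0) A) Φ G R (c + u)) -
        Pn * Real.log R ^ n * orthInt (n + 1) G Φ c| ≤ B * IG := by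
      rw [hsucc, ← integral_const_mul, ← integral_sub hintR (hintI'.const_mul _)]
      have hbd : ∀ u, ‖G u * rFoldSum n (Fin.tail W) (bumpA (W 0) A) Φ G R (c + u) -
          Pn * Real.log R ^ n * (G u * orthInt n G Φ (c + u))‖ ≤ B * G u := fun u => by
        rw [show G u * rFoldSum n (Fin.tail W) (bumpA (W 0) A) Φ G R (c + u) -
            Pn * Real.log R ^ n * (G u * orthInt n G Φ (c + u)) =
            G u * (rFoldSum n (Fin.tail W) (bumpA (W 0) A) Φ G R (c + u) -
              Pn * Real.log R ^ n * orthInt n G Φ (c + u)) by ring, Real.norm_eq_abs, abs_mul,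
          abs_of_nonneg (hG0 u), mul_comm B]
        exact mul_le_mul_of_nonneg_left ((ihΦ u).2.trans_eq (by rw [hBdef])) (hG0 u)
      have hGI : IntegrableOn G (Set.Ici (0 : ℝ)) := (integrable_indicator_iff measurableSet_Ici).1 hGi
      have h := norm_integral_le_of_norm_le (hGI.const_mul B) (ae_of_all _ hbd)
      rw [Real.norm_eq_abs, integral_const_mul, hIG] at h
      exact h
    -- (viii) assembly
    have hF1le : rFoldSum n (Fin.tail W) (bumpA (W 0) A) (fun _ => 1) G R 0 ≤
        Pn * Real.log R ^ n * IG ^ n * (1 + δ) := by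
      have h := (abs_le.1 ih1b).2
      have : Pn * Real.log R ^ n * IG ^ n * (1 + 0) * δ = Pn * Real.log R ^ n * IG ^ n * δ := by ring
      linarith
    rw [hT, hpi]
    have hsplit : ∑ m ∈ rBox n R, w m * P m * S m - cs * Pn * Real.log R ^ (n + 1) * orthInt (n + 1) G Φ c =
        (∑ m ∈ rBox n R, w m * P m * S m - cs * Real.log R * ∑ m ∈ rBox n R, w' m * P m * J m) +
        cs * Real.log R * ((∫ u in Set.Ici (0 : ℝ),
            G u * rFoldSum n (Fin.tail W) (bumpA (W 0) A) Φ G R (c + u)) -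
          Pn * Real.log R ^ n * orthInt (n + 1) G Φ c) := by
      rw [hmain]; ring
    rw [hsplit]
    refine (abs_add_le _ _).trans ?_
    rw [abs_mul, abs_of_nonneg (mul_nonneg hcs0 hlogR.le)]
    refine (add_le_add hE1 (mul_le_mul_of_nonneg_left hE2 (mul_nonneg hcs0 hlogR.le))).trans ?_
    -- the final algebra: `1 + δ_{n+1} = (1 + δ_n)(1 + ε)`
    have hY : C * cs * Λ * (Gs * (Φ₀ + Φ₁)) * rFoldSum n (Fin.tail W) (bumpA (W 0) A) (fun _ => 1) G R 0 ≤
        C * cs * Λ * (Gs * (Φ₀ + Φ₁)) * (Pn * Real.log R ^ n * IG ^ n * (1 + δ)) :=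
      mul_le_mul_of_nonneg_left hF1le
        (mul_nonneg (mul_nonneg (mul_nonneg hC0 hcs0) hΛ0) (mul_nonneg hGsnn (add_nonneg hΦ0nn hΦ1nn)))
    refine (add_le_add hY le_rfl).trans (le_of_eq ?_)
    rw [hBdef, hδdef, ← hεdef, pow_succ]
    have hCΛ : C * cs * Λ * (Gs * (Φ₀ + Φ₁)) = cs * (Φ₀ + Φ₁) * (ε * (IG * Real.log R)) := by
      rw [hεmul]; ring
    rw [hCΛ]
    ring

/-- **Maynard 2016, Lemma 8.4 (all `r`), explicit form.**  There is an absolute `C ≥ 0` such that for every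
`n`, `W : Fin n → ℕ` (each `≠ 0` and a multiple of every prime `p ≤ 2K²`, `K ≥ 2`), `A > 0` at primes with
`|1 + A(p) − p| + n ≤ K` (printed: `g(p) = p + O(k)`, `k` large), `G ∈ C¹` with `G ≥ 0`, `G = 0` on `[1, ∞)`,
`|G| + |G'| ≤ G_s` on `[0,1]`, `∫₀^∞ G = I_G > 0`, `Φ ∈ C¹` with `|Φ| ≤ Φ₀`, `|Φ'| ≤ Φ₁`, `R ≥ 2`, and
`9 + ∑_{p ∣ M} log p/p ≤ Λ` for all `M ≤ Wᵢ ⌈R⌉^n` (printed `L ≪ log log R`):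
`Π_n ≥ 0` and `|rFoldSum_n(W, A, Φ, G, R, c) − Π_n (log R)^n I_n(Φ, c)| ≤ Π_n (log R)^n I_G^n (Φ₀ + Φ₁)((1 + ε)^n − 1)`,
`ε = C Λ G_s/(I_G log R)` (so `≪ n ε` when `nε ≪ 1`: the printed `O(r Ω_G Π (log R)^{r−1} log log R ∫∏G)` with
`Ω_G = G_s/I_G`).  Proof = the printed induction: peel (`rFoldSum_succ`), Lemma 8.3 pointwise in the integrated
variables (`lemma83_gamma84`), `c_{γ_m} = c⋆ ρ_m` (`cGamma_gamma84_mul`) absorbed into the next weight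
(`rWeight_bumpA`), Fubini (`orthInt_succ`), and the error recursion `1 + δ_{n+1} = (1 + δ_n)(1 + ε)`.
[cite: Maynard2016DenseClusters, Lemma 8.4 with proof (8.9)–(8.19)] -/
theorem lemma84_all :
    ∃ C : ℝ, 0 ≤ C ∧ ∀ (n : ℕ) (W : Fin n → ℕ) (K : ℝ) (A : ℕ → ℝ) (G Φ : ℝ → ℝ)
        (Gs IG Φ₀ Φ₁ Λ R c : ℝ),
      2 ≤ K → (∀ i, W i ≠ 0) → (∀ i, ∀ p : ℕ, p.Prime → (p : ℝ) ≤ 2 * K ^ 2 → p ∣ W i) →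
      (∀ p : ℕ, p.Prime → 0 < A p) → (∀ p : ℕ, p.Prime → |1 + A p - p| + n ≤ K) →
      ContDiff ℝ 1 G → (∀ t, 0 ≤ G t) → (∀ t, 1 ≤ t → G t = 0) →
      Integrable ((Set.Ici (0 : ℝ)).indicator G) →
      (∀ t ∈ Set.Icc (0 : ℝ) 1, |G t| + |deriv G t| ≤ Gs) →
      (∫ u in Set.Ici (0 : ℝ), G u) = IG → 0 < IG →
      ContDiff ℝ 1 Φ → (∀ x, |Φ x| ≤ Φ₀) → (∀ x, |deriv Φ x| ≤ Φ₁) → 2 ≤ R →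
      (∀ i, ∀ M : ℕ, M ≠ 0 → (M : ℝ) ≤ (W i : ℝ) * (⌈R⌉₊ : ℝ) ^ n →
          9 + ∑ p ∈ M.primeFactors, Real.log p / p ≤ Λ) →
      0 ≤ piRec n W A ∧
        |rFoldSum n W A Φ G R c - piRec n W A * Real.log R ^ n * orthInt n G Φ c| ≤
          piRec n W A * Real.log R ^ n * IG ^ n * (Φ₀ + Φ₁) *
            ((1 + C * Λ * Gs / (IG * Real.log R)) ^ n - 1) := by
  obtain ⟨C, hC0, hC⟩ := lemma84_all_dec
  refine ⟨C, hC0, fun n W K A G Φ Gs IG Φ₀ Φ₁ Λ R c hK hW hsm hA hAK => ?_⟩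
  exact hC n W K K A G Φ Gs IG Φ₀ Φ₁ Λ R c hK (by nlinarith) hW hsm hA hAK

/-! ## §5 `Π` as the printed Euler product `∏_p (1 + n(p)/g(p))(1 − 1/p)^r` -/

/-- `n(p) = #{i : p ∤ W_i}`. [cite: Maynard2016DenseClusters, Lemma 8.4 (definition of n(p))] -/
def nW (r : ℕ) (W : Fin r → ℕ) (p : ℕ) : ℕ := ∑ i : Fin r, if p ∣ W i then 0 else 1

/-- The partial Euler products `∏_{p<y} (1 + n(p)/A(p))(1 − 1/p)^r` of `Π_g` (printed `g = A`).
[cite: Maynard2016DenseClusters, Lemma 8.4 (definition of Π_g)] -/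
def piPartial (r : ℕ) (W : Fin r → ℕ) (A : ℕ → ℝ) (y : ℕ) : ℝ :=
  ∏ p ∈ Nat.primesBelow y, ((1 + (nW r W p : ℝ) / A p) * (1 - 1 / (p : ℝ)) ^ r)

/-- `n(p)` with the first modulus singled out: `n_{r+1}(W)(p) = n_r(W_1..)(p) + 1_{p ∤ W_0}`.
[cite: Maynard2016DenseClusters, proof of Lemma 8.4 (8.11) (n_j(p))] -/
theorem nW_succ {r : ℕ} (W : Fin (r + 1) → ℕ) (p : ℕ) :
    nW (r + 1) W p = nW r (Fin.tail W) p + (if p ∣ W 0 then 0 else 1) := by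
  unfold nW
  rw [Fin.sum_univ_succ, add_comm]
  rfl

/-- The telescoping of the Euler factors: the `p`-factor of `c_γ(W_0, 1 + A)` times the `p`-factor of
`Π_r(W_1.., bumpA W_0 A)` is the `p`-factor of `Π_{r+1}(W, A)` (`A(p) > 0`).
[cite: Maynard2016DenseClusters, proof of Lemma 8.4 (8.11) (c_j → c_{j+1})] -/
theorem piFactor_succ {r : ℕ} (W : Fin (r + 1) → ℕ) {A : ℕ → ℝ} {p : ℕ} (hp : p.Prime) (hA : 0 < A p) :
    (1 - gamma84 (W 0) (fun p => 1 + A p) p / p)⁻¹ * (1 - 1 / (p : ℝ)) *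
        ((1 + (nW r (Fin.tail W) p : ℝ) / bumpA (W 0) A p) * (1 - 1 / (p : ℝ)) ^ r) =
      (1 + (nW (r + 1) W p : ℝ) / A p) * (1 - 1 / (p : ℝ)) ^ (r + 1) := by
  have hp0 : (p : ℝ) ≠ 0 := by exact_mod_cast hp.ne_zero
  have hA0 : A p ≠ 0 := hA.ne'
  have hA1 : A p + 1 ≠ 0 := by linarith
  rw [nW_succ W p]
  unfold bumpA
  by_cases h : p ∣ W 0
  · rw [if_pos h, if_pos h, gamma84_of_dvd _ h, Nat.cast_add, Nat.cast_zero, add_zero, zero_div, sub_zero,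
      inv_one, one_mul, pow_succ]
    ring
  · rw [if_neg h, if_neg h, gamma84_of_not_dvd _ h, Nat.cast_add, Nat.cast_one, pow_succ]
    have h1 : (1 : ℝ) + A p ≠ 0 := by linarith
    have hγ : (1 - (p : ℝ) / (1 + A p) / p)⁻¹ = (1 + A p) / A p := by
      rw [div_div, mul_comm, ← div_div, div_self hp0, one_sub_div h1, add_sub_cancel_left, inv_div]
    rw [hγ]
    generalize (1 - 1 / (p : ℝ)) = q
    field_simp
    ring

/-- Partial products: `cGammaPartial(γ_{W_0}) y · piPartial_r(W_1.., A') y = piPartial_{r+1}(W, A) y`.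
[cite: Maynard2016DenseClusters, proof of Lemma 8.4 (8.11)] -/
theorem cGammaPartial_mul_piPartial {r : ℕ} (W : Fin (r + 1) → ℕ) {A : ℕ → ℝ}
    (hA : ∀ p : ℕ, p.Prime → 0 < A p) (y : ℕ) :
    GGPY.cGammaPartial (gamma84 (W 0) fun p => 1 + A p) y * piPartial r (Fin.tail W) (bumpA (W 0) A) y =
      piPartial (r + 1) W A y := by
  unfold GGPY.cGammaPartial piPartial
  rw [← Finset.prod_mul_distrib]
  exact Finset.prod_congr rfl fun p hp => piFactor_succ W (Nat.mem_primesBelow.1 hp).2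
    (hA p (Nat.mem_primesBelow.1 hp).2)

/-- **`Π` is the printed Euler product** (decoupled hypotheses of `lemma84_all_dec` on `W, A, K₀, K₁`, so that
every `c_γ` along the recursion converges, by the tree's proved GGPY Lemma 3): the partial products
`∏_{p<y}(1 + n(p)/A(p))(1 − 1/p)^r` converge to `piRec r W A`.
[cite: Maynard2016DenseClusters, Lemma 8.4 (Π_g = ∏_p (1 + n(p)/g(p))(1 − 1/p)^r) with proof (8.11)] -/
theorem tendsto_piPartial_dec :
    ∀ (r : ℕ) (W : Fin r → ℕ) (K₀ K₁ : ℝ) (A : ℕ → ℝ), 2 ≤ K₀ → K₁ ≤ K₀ ^ 2 → (∀ i, W i ≠ 0) →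
      (∀ i, ∀ p : ℕ, p.Prime → (p : ℝ) ≤ 2 * K₀ ^ 2 → p ∣ W i) →
      (∀ p : ℕ, p.Prime → 0 < A p) → (∀ p : ℕ, p.Prime → |1 + A p - p| + r ≤ K₁) →
      Tendsto (piPartial r W A) atTop (𝓝 (piRec r W A)) := by
  intro r
  induction r with
  | zero =>
    intro W K₀ K₁ A hK₀ hK₁ hW hsm hA hAK
    have : piPartial 0 W A = fun _ => 1 := by
      funext y; unfold piPartial; simp
    rw [this]
    simp only [piRec]
    exact tendsto_const_nhds
  | succ r ih =>
    intro W K₀ K₁ A hK₀ hK₁ hW hsm hA hAK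
    have haK : ∀ p : ℕ, p.Prime → ¬p ∣ W 0 → |(fun p => 1 + A p) p - p| ≤ K₁ := fun p hp _ => by
      have h := hAK p hp
      have : (0 : ℝ) ≤ (r + 1 : ℕ) := Nat.cast_nonneg _
      simp only
      push_cast at h
      linarith
    have hconv := tendsto_cGammaPartial_gamma84_dec (hW 0) hK₀ hK₁ haK (hsm 0)
    have hA' : ∀ p : ℕ, p.Prime → 0 < bumpA (W 0) A p := fun p hp => bumpA_pos (hA p hp)
    have hAK' : ∀ p : ℕ, p.Prime → |1 + bumpA (W 0) A p - p| + r ≤ K₁ := fun p hp => by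
      have h1 := abs_bumpA_le (W 0) A p
      have h2 := hAK p hp
      push_cast at h2
      linarith
    have ih' := ih (Fin.tail W) K₀ K₁ (bumpA (W 0) A) hK₀ hK₁ (fun i => hW i.succ) (fun i => hsm i.succ)
      hA' hAK'
    have h := hconv.mul ih'
    refine (h.congr fun y => ?_)
    exact cGammaPartial_mul_piPartial W hA y

/-- **`Π` is the printed Euler product**: under the hypotheses of `lemma84_all` on `W, A, K` (so that every
`c_γ` along the recursion converges, by the tree's proved GGPY Lemma 3), the partial products
`∏_{p<y}(1 + n(p)/A(p))(1 − 1/p)^r` converge to `piRec r W A`.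
[cite: Maynard2016DenseClusters, Lemma 8.4 (Π_g = ∏_p (1 + n(p)/g(p))(1 − 1/p)^r) with proof (8.11)] -/
theorem tendsto_piPartial :
    ∀ (r : ℕ) (W : Fin r → ℕ) (K : ℝ) (A : ℕ → ℝ), 2 ≤ K → (∀ i, W i ≠ 0) →
      (∀ i, ∀ p : ℕ, p.Prime → (p : ℝ) ≤ 2 * K ^ 2 → p ∣ W i) →
      (∀ p : ℕ, p.Prime → 0 < A p) → (∀ p : ℕ, p.Prime → |1 + A p - p| + r ≤ K) →
      Tendsto (piPartial r W A) atTop (𝓝 (piRec r W A)) := by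
  intro r W K A hK hW hsm hA hAK
  exact tendsto_piPartial_dec r W K K A hK (by nlinarith) hW hsm hA hAK

/-! ## §6 The hypotheses of `lemma84_all` for the profiles of `F`: `G = g_k`, `G = g_k²`, `Φ = ψ`, `Φ = ψ²` -/

/-- `g_k` (its smooth representative `profExt k`) vanishes on `[1, ∞)` (indeed on `[U_k, ∞)`, `U_k ≤ 1`).
[cite: Maynard2016DenseClusters, Lemma 8.4 («G supported on [0,1]») with (7.4)] -/
theorem profExt_eq_zero_of_one_le {k : ℕ} (hk : 2 ≤ k) {t : ℝ} (ht : 1 ≤ t) : profExt k t = 0 := by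
  have hk1 : 1 ≤ k := le_trans (by norm_num) hk
  rw [profExt_of_nonneg hk (by linarith)]
  exact prof_eq_zero hk1 ((U_le_one hk1).trans ht)

/-- `1_{[0,∞)} profExt k = profCut k`. [cite: Maynard2016DenseClusters, Lemma 8.6 (integrals over [0,∞))] -/
theorem indicator_profExt {k : ℕ} (hk : 2 ≤ k) : (Set.Ici (0 : ℝ)).indicator (profExt k) = profCut k := by
  funext t
  by_cases ht : (0 : ℝ) ≤ t
  · rw [Set.indicator_of_mem (Set.mem_Ici.2 ht), profCut_of_nonneg ht, profExt_of_nonneg hk ht]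
  · rw [Set.indicator_of_notMem (fun h => ht (Set.mem_Ici.1 h)), profCut_of_neg (not_le.1 ht)]

/-- **The `G`-hypotheses of `lemma84_all` for `G = g_k`** (`k ≥ 2`): `C¹`, `≥ 0`, `= 0` on `[1,∞)`,
`1_{[0,∞)}G` integrable, `|G| + |G'| ≤ 1 + 30/U_k + T_k` on `[0,1]` (`≤ 2T_k` for `k ≥ 2^18`),
`∫₀^∞ G = L_k = ell k > 0`. [cite: Maynard2016DenseClusters, Lemma 8.5 (proof: «we have a bound on G, Φ which corresponds to Ω_G = O(kT_k)»)] -/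
theorem lemma84_hypG_profExt {k : ℕ} (hk : 2 ≤ k) :
    ContDiff ℝ 1 (profExt k) ∧ (∀ t, 0 ≤ profExt k t) ∧ (∀ t, 1 ≤ t → profExt k t = 0) ∧
      Integrable ((Set.Ici (0 : ℝ)).indicator (profExt k)) ∧
      (∀ t ∈ Set.Icc (0 : ℝ) 1, |profExt k t| + |deriv (profExt k) t| ≤ 1 + 30 / U k + T k) ∧
      (∫ u in Set.Ici (0 : ℝ), profExt k u) = ell k ∧ 0 < ell k :=
  ⟨contDiff_profExt hk, fun t => (profExt_mem_Icc hk t).1, fun _ ht => profExt_eq_zero_of_one_le hk ht,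
    by rw [indicator_profExt hk]; exact integrable_profCut hk,
    fun _ ht => abs_profExt_add_abs_deriv_le hk ht.1, setIntegral_Ici_profExt hk, ell_pos hk⟩

/-- **The `G`-hypotheses of `lemma84_all` for `G = g_k²`** (the profile of `F²`, `k ≥ 2`): `C¹`, `≥ 0`, `= 0` on
`[1,∞)`, integrable, `|G| + |G'| ≤ 2(1 + 30/U_k + T_k)` on `[0,1]`, `∫₀^∞ G = γ_k = gam k > 0`.
[cite: Maynard2016DenseClusters, Proposition 9.1 (proof, the sum of y_r² via Lemma 8.4) with Lemma 8.6] -/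
theorem lemma84_hypG_profExt_sq {k : ℕ} (hk : 2 ≤ k) :
    ContDiff ℝ 1 (fun t => profExt k t ^ 2) ∧ (∀ t, 0 ≤ profExt k t ^ 2) ∧
      (∀ t, 1 ≤ t → profExt k t ^ 2 = 0) ∧
      Integrable ((Set.Ici (0 : ℝ)).indicator fun t => profExt k t ^ 2) ∧
      (∀ t ∈ Set.Icc (0 : ℝ) 1,
        |profExt k t ^ 2| + |deriv (fun t => profExt k t ^ 2) t| ≤ 2 * (1 + 30 / U k + T k)) ∧
      (∫ u in Set.Ici (0 : ℝ), profExt k u ^ 2) = gam k ∧ 0 < gam k := by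
  have hcd : ContDiff ℝ 1 (profExt k) := contDiff_profExt hk
  have hind : (Set.Ici (0 : ℝ)).indicator (fun t => profExt k t ^ 2) = fun t => profCut k t ^ 2 := by
    funext t
    have h := congrFun (indicator_profExt hk) t
    by_cases ht : t ∈ Set.Ici (0 : ℝ)
    · rw [Set.indicator_of_mem ht] at h ⊢; rw [h]
    · rw [Set.indicator_of_notMem ht] at h ⊢; rw [← h]; ring
  refine ⟨hcd.pow 2, fun t => sq_nonneg _, fun t ht => by rw [profExt_eq_zero_of_one_le hk ht]; ring,
    by rw [hind]; exact integrable_profCut_sq hk, fun t ht => ?_, ?_, gam_pos hk⟩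
  · have hd : HasDerivAt (fun t => profExt k t ^ 2) (((2 : ℕ) : ℝ) * profExt k t ^ (2 - 1) * deriv (profExt k) t) t :=
      ((hcd.differentiable (by simp)).differentiableAt.hasDerivAt).pow 2
    rw [hd.deriv]
    have h0 : 0 ≤ profExt k t := (profExt_mem_Icc hk t).1
    have h1 : profExt k t ≤ 1 := by rw [profExt_of_nonneg hk ht.1]; exact prof_le_one hk ht.1
    have hb := abs_profExt_add_abs_deriv_le hk ht.1
    rw [abs_of_nonneg h0] at hb
    simp only [Nat.cast_ofNat, Nat.add_one_sub_one, pow_one]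
    rw [abs_of_nonneg (sq_nonneg _), abs_mul, abs_mul, abs_of_nonneg h0, abs_two]
    nlinarith [abs_nonneg (deriv (profExt k) t), mul_le_mul_of_nonneg_right h1 h0,
      mul_le_mul_of_nonneg_right h1 (abs_nonneg (deriv (profExt k) t))]
  · rw [← integral_indicator measurableSet_Ici, hind, gam]

/-- **The `Φ`-hypotheses of `lemma84_all` for `Φ = ψ`**: `C¹`, `|ψ| ≤ 1`, `|ψ'| ≤ 30`.
[cite: Maynard2016DenseClusters, Lemma 8.4 («Φ(t), Φ'(t) ≪ 1») with (7.4)] -/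
theorem lemma84_hypPhi_psi : ContDiff ℝ 1 psi ∧ (∀ x, |psi x| ≤ 1) ∧ ∀ x, |deriv psi x| ≤ 30 :=
  ⟨contDiff_psi, fun x => by rw [abs_of_nonneg (psi_nonneg x)]; exact psi_le_one x, abs_deriv_psi_le⟩

/-- **The `Φ`-hypotheses of `lemma84_all` for `Φ = ψ²`** (the profile of `F²`): `C¹`, `|ψ²| ≤ 1`, `|(ψ²)'| ≤ 60`.
[cite: Maynard2016DenseClusters, Proposition 9.1 (proof) with (7.4)] -/
theorem lemma84_hypPhi_psi_sq :
    ContDiff ℝ 1 (fun x => psi x ^ 2) ∧ (∀ x, |psi x ^ 2| ≤ 1) ∧ ∀ x, |deriv (fun x => psi x ^ 2) x| ≤ 60 := by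
  refine ⟨contDiff_psi.pow 2, fun x => ?_, fun x => ?_⟩
  · rw [abs_of_nonneg (sq_nonneg _)]
    have h0 := psi_nonneg x
    have h1 := psi_le_one x
    nlinarith
  · have hd : HasDerivAt (fun x => psi x ^ 2) (((2 : ℕ) : ℝ) * psi x ^ (2 - 1) * deriv psi x) x :=
      (hasDerivAt_psi x).differentiableAt.hasDerivAt.pow 2
    rw [hd.deriv]
    simp only [Nat.cast_ofNat, Nat.add_one_sub_one, pow_one]
    rw [abs_mul, abs_mul, abs_two, abs_of_nonneg (psi_nonneg x)]
    have h1 := psi_le_one x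
    have h2 := abs_deriv_psi_le x
    nlinarith [abs_nonneg (deriv psi x), psi_nonneg x]

/-! ## §7 The printed shape of the error: `(1 + ε)^r − 1 ≤ 2rε` for `rε ≤ 1` -/

/-- `(1 + ε)^n − 1 ≤ 2nε` for `0 ≤ ε`, `nε ≤ 1` (`(1+ε)^n ≤ e^{nε}` and `e^x − 1 ≤ 2x` on `[0,1]`).
[cite: Maynard2016DenseClusters, proof of Lemma 8.4 («Σ_ℓ binom(j,ℓ) O(Ω_G log log R/log R)^ℓ», the hypothesis rΩ_G = o(log R/log log R))] -/
theorem pow_sub_one_le_two_mul {ε : ℝ} {n : ℕ} (hε : 0 ≤ ε) (hn : (n : ℝ) * ε ≤ 1) :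
    (1 + ε) ^ n - 1 ≤ 2 * ((n : ℝ) * ε) := by
  have h1 : (1 + ε) ^ n ≤ Real.exp ((n : ℝ) * ε) := by
    calc (1 + ε) ^ n ≤ Real.exp ε ^ n :=
          pow_le_pow_left₀ (by linarith) (by linarith [Real.add_one_le_exp ε]) n
      _ = Real.exp ((n : ℝ) * ε) := by rw [← Real.exp_nat_mul]
  have h2 : |Real.exp ((n : ℝ) * ε) - 1| ≤ 2 * |(n : ℝ) * ε| :=
    Real.abs_exp_sub_one_le (by rw [abs_of_nonneg (by positivity)]; exact hn)
  rw [abs_of_nonneg (by positivity : (0 : ℝ) ≤ (n : ℝ) * ε)] at h2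
  linarith [(abs_le.1 h2).2]

/-- **Lemma 8.4 in the printed shape**: with `ε = CΛG_s/(I_G log R)` and `nε ≤ 1`,
`|rFoldSum_n − Π_n (log R)^n I_n(Φ, c)| ≤ 2 n ε · Π_n (log R)^n I_G^n (Φ₀ + Φ₁)`
(= `O(r Ω_G Π (log R)^{r−1} Λ ∫∏G)` with `Ω_G = G_s/I_G`, `Λ ≍ log log R`).
[cite: Maynard2016DenseClusters, Lemma 8.4] -/
theorem lemma84_all' :
    ∃ C : ℝ, 0 ≤ C ∧ ∀ (n : ℕ) (W : Fin n → ℕ) (K : ℝ) (A : ℕ → ℝ) (G Φ : ℝ → ℝ)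
        (Gs IG Φ₀ Φ₁ Λ R c : ℝ),
      2 ≤ K → (∀ i, W i ≠ 0) → (∀ i, ∀ p : ℕ, p.Prime → (p : ℝ) ≤ 2 * K ^ 2 → p ∣ W i) →
      (∀ p : ℕ, p.Prime → 0 < A p) → (∀ p : ℕ, p.Prime → |1 + A p - p| + n ≤ K) →
      ContDiff ℝ 1 G → (∀ t, 0 ≤ G t) → (∀ t, 1 ≤ t → G t = 0) →
      Integrable ((Set.Ici (0 : ℝ)).indicator G) →
      (∀ t ∈ Set.Icc (0 : ℝ) 1, |G t| + |deriv G t| ≤ Gs) →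
      (∫ u in Set.Ici (0 : ℝ), G u) = IG → 0 < IG →
      ContDiff ℝ 1 Φ → (∀ x, |Φ x| ≤ Φ₀) → (∀ x, |deriv Φ x| ≤ Φ₁) → 2 ≤ R →
      (∀ i, ∀ M : ℕ, M ≠ 0 → (M : ℝ) ≤ (W i : ℝ) * (⌈R⌉₊ : ℝ) ^ n →
          9 + ∑ p ∈ M.primeFactors, Real.log p / p ≤ Λ) →
      (n : ℝ) * (C * Λ * Gs / (IG * Real.log R)) ≤ 1 →
      0 ≤ piRec n W A ∧
        |rFoldSum n W A Φ G R c - piRec n W A * Real.log R ^ n * orthInt n G Φ c| ≤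
          2 * ((n : ℝ) * (C * Λ * Gs / (IG * Real.log R))) *
            (piRec n W A * Real.log R ^ n * IG ^ n * (Φ₀ + Φ₁)) := by
  obtain ⟨C, hC0, hC⟩ := lemma84_all
  refine ⟨C, hC0, fun n W K A G Φ Gs IG Φ₀ Φ₁ Λ R c hK hW hsm hA hAK hG hG0 hG1 hGi hGs hIG hIGpos hΦ hΦ0 hΦ1
    hR hΛ hsmall => ?_⟩
  obtain ⟨hpi, hb⟩ := hC n W K A G Φ Gs IG Φ₀ Φ₁ Λ R c hK hW hsm hA hAK hG hG0 hG1 hGi hGs hIG hIGpos hΦ hΦ0 hΦ1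
    hR hΛ
  refine ⟨hpi, hb.trans ?_⟩
  have hlogR : 0 < Real.log R := Real.log_pos (by linarith)
  have hΦ0nn : 0 ≤ Φ₀ := (abs_nonneg _).trans (hΦ0 0)
  have hΦ1nn : 0 ≤ Φ₁ := (abs_nonneg _).trans (hΦ1 0)
  have hGsnn : 0 ≤ Gs := le_trans (by positivity) (hGs 0 ⟨le_rfl, zero_le_one⟩)
  have hX : 0 ≤ piRec n W A * Real.log R ^ n * IG ^ n * (Φ₀ + Φ₁) :=
    mul_nonneg (mul_nonneg (mul_nonneg hpi (pow_nonneg hlogR.le n)) (pow_nonneg hIGpos.le n))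
      (add_nonneg hΦ0nn hΦ1nn)
  cases n with
  | zero => simp
  | succ m =>
    have hΛ0 : 0 ≤ Λ := by
      have h := hΛ 0 1 one_ne_zero (by
        have h1 : (1 : ℝ) ≤ W 0 := by exact_mod_cast Nat.one_le_iff_ne_zero.2 (hW 0)
        have hc : (1 : ℝ) ≤ (⌈R⌉₊ : ℝ) := by
          have : (1 : ℕ) ≤ ⌈R⌉₊ :=
            Nat.one_le_iff_ne_zero.2 (Nat.pos_iff_ne_zero.1 (Nat.ceil_pos.2 (by linarith)))
          exact_mod_cast this
        calc ((1 : ℕ) : ℝ) = 1 * 1 := by norm_num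
          _ ≤ (W 0 : ℝ) * (⌈R⌉₊ : ℝ) ^ (m + 1) :=
              mul_le_mul h1 (one_le_pow₀ hc) zero_le_one (by linarith))
      have : 0 ≤ ∑ p ∈ (1 : ℕ).primeFactors, Real.log p / p := by simp
      linarith
    have hε : 0 ≤ C * Λ * Gs / (IG * Real.log R) := by positivity
    rw [mul_comm (2 * _)]
    exact mul_le_mul_of_nonneg_left (pow_sub_one_le_two_mul hε hsmall) hX

/-- **Lemma 8.4 in the printed shape, decoupled hypotheses** (`K₀`: threshold, `K₁ ≤ K₀²`: deviation): with
`ε = CΛG_s/(I_G log R)` and `nε ≤ 1`, `|rFoldSum_n − Π_n (log R)^n I_n(Φ, c)| ≤ 2 n ε · Π_n (log R)^n I_G^n (Φ₀ + Φ₁)`.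
[cite: Maynard2016DenseClusters, Lemma 8.4] -/
theorem lemma84_all'_dec :
    ∃ C : ℝ, 0 ≤ C ∧ ∀ (n : ℕ) (W : Fin n → ℕ) (K₀ K₁ : ℝ) (A : ℕ → ℝ) (G Φ : ℝ → ℝ)
        (Gs IG Φ₀ Φ₁ Λ R c : ℝ),
      2 ≤ K₀ → K₁ ≤ K₀ ^ 2 → (∀ i, W i ≠ 0) →
      (∀ i, ∀ p : ℕ, p.Prime → (p : ℝ) ≤ 2 * K₀ ^ 2 → p ∣ W i) →
      (∀ p : ℕ, p.Prime → 0 < A p) → (∀ p : ℕ, p.Prime → |1 + A p - p| + n ≤ K₁) →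
      ContDiff ℝ 1 G → (∀ t, 0 ≤ G t) → (∀ t, 1 ≤ t → G t = 0) →
      Integrable ((Set.Ici (0 : ℝ)).indicator G) →
      (∀ t ∈ Set.Icc (0 : ℝ) 1, |G t| + |deriv G t| ≤ Gs) →
      (∫ u in Set.Ici (0 : ℝ), G u) = IG → 0 < IG →
      ContDiff ℝ 1 Φ → (∀ x, |Φ x| ≤ Φ₀) → (∀ x, |deriv Φ x| ≤ Φ₁) → 2 ≤ R →
      (∀ i, ∀ M : ℕ, M ≠ 0 → (M : ℝ) ≤ (W i : ℝ) * (⌈R⌉₊ : ℝ) ^ n →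
          9 + ∑ p ∈ M.primeFactors, Real.log p / p ≤ Λ) →
      (n : ℝ) * (C * Λ * Gs / (IG * Real.log R)) ≤ 1 →
      0 ≤ piRec n W A ∧
        |rFoldSum n W A Φ G R c - piRec n W A * Real.log R ^ n * orthInt n G Φ c| ≤
          2 * ((n : ℝ) * (C * Λ * Gs / (IG * Real.log R))) *
            (piRec n W A * Real.log R ^ n * IG ^ n * (Φ₀ + Φ₁)) := by
  obtain ⟨C, hC0, hC⟩ := lemma84_all_dec
  refine ⟨C, hC0, fun n W K₀ K₁ A G Φ Gs IG Φ₀ Φ₁ Λ R c hK₀ hK₁ hW hsm hA hAK hG hG0 hG1 hGi hGs hIG hIGpos hΦ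
    hΦ0 hΦ1 hR hΛ hsmall => ?_⟩
  obtain ⟨hpi, hb⟩ := hC n W K₀ K₁ A G Φ Gs IG Φ₀ Φ₁ Λ R c hK₀ hK₁ hW hsm hA hAK hG hG0 hG1 hGi hGs hIG hIGpos hΦ
    hΦ0 hΦ1 hR hΛ
  refine ⟨hpi, hb.trans ?_⟩
  have hlogR : 0 < Real.log R := Real.log_pos (by linarith)
  have hΦ0nn : 0 ≤ Φ₀ := (abs_nonneg _).trans (hΦ0 0)
  have hΦ1nn : 0 ≤ Φ₁ := (abs_nonneg _).trans (hΦ1 0)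
  have hGsnn : 0 ≤ Gs := le_trans (by positivity) (hGs 0 ⟨le_rfl, zero_le_one⟩)
  have hX : 0 ≤ piRec n W A * Real.log R ^ n * IG ^ n * (Φ₀ + Φ₁) :=
    mul_nonneg (mul_nonneg (mul_nonneg hpi (pow_nonneg hlogR.le n)) (pow_nonneg hIGpos.le n))
      (add_nonneg hΦ0nn hΦ1nn)
  cases n with
  | zero => simp
  | succ m =>
    have hΛ0 : 0 ≤ Λ := by
      have h := hΛ 0 1 one_ne_zero (by
        have h1 : (1 : ℝ) ≤ W 0 := by exact_mod_cast Nat.one_le_iff_ne_zero.2 (hW 0)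
        have hc : (1 : ℝ) ≤ (⌈R⌉₊ : ℝ) := by
          have : (1 : ℕ) ≤ ⌈R⌉₊ :=
            Nat.one_le_iff_ne_zero.2 (Nat.pos_iff_ne_zero.1 (Nat.ceil_pos.2 (by linarith)))
          exact_mod_cast this
        calc ((1 : ℕ) : ℝ) = 1 * 1 := by norm_num
          _ ≤ (W 0 : ℝ) * (⌈R⌉₊ : ℝ) ^ (m + 1) :=
              mul_le_mul h1 (one_le_pow₀ hc) zero_le_one (by linarith))
      have : 0 ≤ ∑ p ∈ (1 : ℕ).primeFactors, Real.log p / p := by simp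
      linarith
    have hε : 0 ≤ C * Λ * Gs / (IG * Real.log R) := by positivity
    rw [mul_comm (2 * _)]
    exact mul_le_mul_of_nonneg_left (pow_sub_one_le_two_mul hε hsmall) hX

/-! ## §8 The main-term integral for `F²`: `I_k(g_k², ψ², 0) = I_k(F)` -/

/-- For the profiles of `F²` (`G = g_k²`, `Φ = ψ²`, no shift) the main-term integral of Lemma 8.4 is `I_k(F)`:
`∫_{[0,∞)^k} ψ(Σtᵢ)² ∏ g_k(tᵢ)² dt = I_k(F)` (on the orthant `profExt k = g_k`).
[cite: Maynard2016DenseClusters, Proposition 9.1 (proof: the main term Σ y_r²/… = … (log R)^k I_k(F))] -/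
theorem orthInt_profExt_sq_psi_sq {k : ℕ} (hk : 2 ≤ k) :
    orthInt k (fun t => profExt k t ^ 2) (fun x => psi x ^ 2) 0 = IF k := by
  unfold orthInt IF orthantI
  refine setIntegral_congr_fun (measurableSet_orthant k) fun t ht => ?_
  simp only [zero_add]
  unfold F
  rw [mul_pow, ← Finset.prod_pow]
  congr 1
  exact Finset.prod_congr rfl fun i _ => by rw [profExt_of_nonneg hk (mem_orthant.1 ht i)]

/-! ## §9 The profile `H_ψ(c) = ∫₀^∞ ψ(c + u) g_k(u) du` of `∫ F dt_m` (Lemma 9.3 / Proposition 9.2) -/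

/-- `H_ψ(c) = ∫₀^∞ ψ(c + u) g_k(u) du`: the one-variable factor of `∫₀^∞ F(s; s_m := u) du = H_ψ(Σ_j s_j) ∏_j g_k(s_j)`,
so that `J_k(F) = ∫_{[0,∞)^{k−1}} H_ψ(Σ s_j)² ∏ g_k(s_j)²`, i.e. the main-term integral of Lemma 8.4 for the
`(k−1)`-fold sum of `(y^{(m)}_r)²` is `J_k(F)` with `Φ = H_ψ²`, `G = g_k²`.
[cite: Maynard2016DenseClusters, Proposition 9.2 (proof, (9.13): «J_k(H)… J_k(F)») with Lemma 8.6 (J_k)] -/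
def Hpsi (k : ℕ) (c : ℝ) : ℝ := ∫ u in Set.Ici (0 : ℝ), psi (c + u) * prof k u

/-- `H_ψ` as an integral over the line against the cut-off profile. [cite: Maynard2016DenseClusters, Proposition 9.2 (proof)] -/
theorem Hpsi_eq_integral (k : ℕ) (c : ℝ) : Hpsi k c = ∫ u, psi (c + u) * profCut k u := by
  rw [Hpsi, ← integral_indicator measurableSet_Ici]
  congr 1
  funext u
  by_cases hu : u ∈ Set.Ici (0 : ℝ)
  · rw [Set.indicator_of_mem hu, profCut_of_nonneg (Set.mem_Ici.1 hu)]
  · rw [Set.indicator_of_notMem hu, profCut_of_neg (not_le.1 fun h => hu (Set.mem_Ici.2 h)), mul_zero]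

/-- The fibre integral of `F`: `∫₀^∞ F(s; s_m := u) du = H_ψ(Σ_j s_j) · ∏_j g_k(s_j)`.
[cite: Maynard2016DenseClusters, Proposition 9.2 (proof: y^{(m)} via ∫ F dt_m)] -/
theorem inner_F_eq_Hpsi {n : ℕ} (m : Fin (n + 1)) (s : Fin n → ℝ) :
    ∫ u in Set.Ici (0 : ℝ), F (n + 1) (Fin.insertNth m u s) = Hpsi (n + 1) (∑ j, s j) * ∏ j, prof (n + 1) (s j) := by
  rw [Hpsi, ← integral_mul_const]
  refine setIntegral_congr_fun measurableSet_Ici fun u _ => ?_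
  rw [F_eq_psi_mul_F₁, F₁_insertNth, sum_insertNth, add_comm u]
  ring

/-- **`J_k(F)` is the main-term integral of Lemma 8.4 for `Φ = H_ψ²`, `G = g_k²`** (`k = n + 1`):
`∫_{[0,∞)^n} H_ψ(Σ sⱼ)² ∏ g_k(sⱼ)² ds = J_k(F)`. [cite: Maynard2016DenseClusters, Proposition 9.2 (proof, (9.12)–(9.13))] -/
theorem orthInt_profExt_sq_Hpsi_sq (n : ℕ) (hn : 2 ≤ n + 1) :
    orthInt n (fun t => profExt (n + 1) t ^ 2) (fun x => Hpsi (n + 1) x ^ 2) 0 = JF (n + 1) := by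
  unfold orthInt JF orthantJ
  refine setIntegral_congr_fun (measurableSet_orthant n) fun s hs => ?_
  simp only [zero_add]
  rw [inner_F_eq_Hpsi, mul_pow, ← Finset.prod_pow]
  congr 1
  exact Finset.prod_congr rfl fun j _ => by rw [profExt_of_nonneg hn (mem_orthant.1 hs j)]

/-- The derivative of `H_ψ` under the integral sign: `H_ψ'(c) = ∫ ψ'(c + u) (1_{[0,∞)}g_k)(u) du` (dominated
differentiation: `|ψ'| ≤ 30`, `1_{[0,∞)}g_k` integrable). [cite: Maynard2016DenseClusters, Proposition 9.2 (proof) with Lemma 8.4 (hypothesis «Φ, Φ' ≪ 1»)] -/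
theorem hasDerivAt_Hpsi {k : ℕ} (hk : 2 ≤ k) (c : ℝ) :
    HasDerivAt (Hpsi k) (∫ u, deriv psi (c + u) * profCut k u) c := by
  have hfun : Hpsi k = fun c => ∫ u, psi (c + u) * profCut k u := funext (Hpsi_eq_integral k)
  rw [hfun]
  have hpsic : Continuous psi := contDiff_psi (n := 1) |>.continuous
  have hdpsic : Continuous (deriv psi) := (contDiff_psi (n := 1)).continuous_deriv le_rfl
  have hmeas : ∀ x : ℝ, AEStronglyMeasurable (fun u => psi (x + u) * profCut k u) volume := fun x =>
    ((hpsic.comp (continuous_const.add continuous_id)).measurable.mul (measurable_profCut k)).aestronglyMeasurable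
  have hint : Integrable (fun u => psi (c + u) * profCut k u) :=
    (integrable_profCut hk).bdd_mul (hmeas c |> fun h =>
      ((hpsic.comp (continuous_const.add continuous_id)).aestronglyMeasurable))
      (ae_of_all _ fun u => by
        rw [Real.norm_eq_abs, abs_of_nonneg (psi_nonneg _)]; exact psi_le_one _)
  have hmeas' : AEStronglyMeasurable (fun u => deriv psi (c + u) * profCut k u) volume :=
    ((hdpsic.comp (continuous_const.add continuous_id)).measurable.mul (measurable_profCut k)).aestronglyMeasurable
  refine (hasDerivAt_integral_of_dominated_loc_of_deriv_le (F := fun x u => psi (x + u) * profCut k u)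
    (F' := fun x u => deriv psi (x + u) * profCut k u) (bound := fun u => 30 * |profCut k u|)
    Filter.univ_mem (Filter.Eventually.of_forall hmeas) hint hmeas' ?_ ((integrable_profCut hk).abs.const_mul 30) ?_).2
  · exact ae_of_all _ fun u x _ => by
      rw [Real.norm_eq_abs, abs_mul]
      exact mul_le_mul_of_nonneg_right (abs_deriv_psi_le _) (abs_nonneg _)
  · exact ae_of_all _ fun u x _ => ((hasDerivAt_psi (x + u)).differentiableAt.hasDerivAt.comp_add_const x u).mul_const _

/-- `H_ψ'` is continuous (dominated convergence), hence `H_ψ ∈ C¹`. [cite: Maynard2016DenseClusters, Proposition 9.2 (proof)] -/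
theorem contDiff_Hpsi {k : ℕ} (hk : 2 ≤ k) : ContDiff ℝ 1 (Hpsi k) := by
  have hderiv : deriv (Hpsi k) = fun c => ∫ u, deriv psi (c + u) * profCut k u :=
    funext fun c => (hasDerivAt_Hpsi hk c).deriv
  have hdpsic : Continuous (deriv psi) := (contDiff_psi (n := 1)).continuous_deriv le_rfl
  rw [contDiff_one_iff_deriv]
  refine ⟨fun c => (hasDerivAt_Hpsi hk c).differentiableAt, ?_⟩
  rw [hderiv]
  refine continuous_of_dominated (bound := fun u => 30 * |profCut k u|) (fun x =>
      ((hdpsic.comp (continuous_const.add continuous_id)).measurable.mul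
        (measurable_profCut k)).aestronglyMeasurable)
    (fun x => ae_of_all _ fun u => by
      rw [Real.norm_eq_abs, abs_mul]
      exact mul_le_mul_of_nonneg_right (abs_deriv_psi_le _) (abs_nonneg _))
    ((integrable_profCut hk).abs.const_mul 30)
    (ae_of_all _ fun u => (hdpsic.comp (continuous_id.add continuous_const)).mul continuous_const)

/-- `|H_ψ(c)| ≤ L_k = ell k` (`0 ≤ ψ ≤ 1`). [cite: Maynard2016DenseClusters, Proposition 9.2 (proof) with Lemma 8.6] -/
theorem abs_Hpsi_le {k : ℕ} (hk : 2 ≤ k) (c : ℝ) : |Hpsi k c| ≤ ell k := by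
  rw [Hpsi_eq_integral, ell]
  have h := norm_integral_le_of_norm_le (integrable_profCut hk)
    (ae_of_all _ fun u => show ‖psi (c + u) * profCut k u‖ ≤ profCut k u by
      rw [Real.norm_eq_abs, abs_mul, abs_of_nonneg (psi_nonneg _), abs_of_nonneg (profCut_nonneg hk u)]
      exact mul_le_of_le_one_left (profCut_nonneg hk u) (psi_le_one _))
  rwa [Real.norm_eq_abs] at h

/-- `|H_ψ'(c)| ≤ 30 L_k` (`|ψ'| ≤ 30`). [cite: Maynard2016DenseClusters, Proposition 9.2 (proof) with Lemma 8.4 («Φ' ≪ 1»)] -/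
theorem abs_deriv_Hpsi_le {k : ℕ} (hk : 2 ≤ k) (c : ℝ) : |deriv (Hpsi k) c| ≤ 30 * ell k := by
  rw [(hasDerivAt_Hpsi hk c).deriv, ell, ← integral_const_mul]
  have h := norm_integral_le_of_norm_le ((integrable_profCut hk).const_mul 30)
    (ae_of_all _ fun u => show ‖deriv psi (c + u) * profCut k u‖ ≤ 30 * profCut k u by
      rw [Real.norm_eq_abs, abs_mul, abs_of_nonneg (profCut_nonneg hk u)]
      exact mul_le_mul_of_nonneg_right (abs_deriv_psi_le _) (profCut_nonneg hk u))
  rwa [Real.norm_eq_abs] at h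

/-- **The `Φ`-hypotheses of `lemma84_all` for `Φ = H_ψ²`** (the `(k−1)`-fold sum of Proposition 9.2): `C¹`,
`|H_ψ²| ≤ L_k²`, `|(H_ψ²)'| ≤ 60 L_k²`. [cite: Maynard2016DenseClusters, Proposition 9.2 (proof, the application of Lemma 8.4)] -/
theorem lemma84_hypPhi_Hpsi_sq {k : ℕ} (hk : 2 ≤ k) :
    ContDiff ℝ 1 (fun x => Hpsi k x ^ 2) ∧ (∀ x, |Hpsi k x ^ 2| ≤ ell k ^ 2) ∧
      ∀ x, |deriv (fun x => Hpsi k x ^ 2) x| ≤ 60 * ell k ^ 2 := by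
  have hcd := contDiff_Hpsi hk
  refine ⟨hcd.pow 2, fun x => ?_, fun x => ?_⟩
  · rw [abs_of_nonneg (sq_nonneg _), ← sq_abs]
    exact pow_le_pow_left₀ (abs_nonneg _) (abs_Hpsi_le hk x) 2
  · have hd : HasDerivAt (fun x => Hpsi k x ^ 2) (((2 : ℕ) : ℝ) * Hpsi k x ^ (2 - 1) * deriv (Hpsi k) x) x :=
      (hasDerivAt_Hpsi hk x).differentiableAt.hasDerivAt.pow 2
    rw [hd.deriv]
    simp only [Nat.cast_ofNat, Nat.add_one_sub_one, pow_one]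
    rw [abs_mul, abs_mul, abs_two]
    have h1 := abs_Hpsi_le hk x
    have h2 := abs_deriv_Hpsi_le hk x
    have h0 : 0 ≤ ell k := (ell_pos hk).le
    nlinarith [abs_nonneg (Hpsi k x), abs_nonneg (deriv (Hpsi k) x), mul_le_mul h1 h2 (abs_nonneg _) h0]

/-! ## §10 Re-indexing: the box `1 ≤ eᵢ ≤ ⌊R⌋` (FGKMT's `𝒟_k` convention) gives the same sum -/

/-- `rBox r R ⊆ ∏ Icc 1 ⌊R⌋₊`. [cite: Maynard2016DenseClusters, Lemma 8.4 (the sum over e ∈ ℕ^r)] -/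
theorem rBox_subset_piFinset_Icc (r : ℕ) (R : ℝ) :
    rBox r R ⊆ Fintype.piFinset fun _ : Fin r => Finset.Icc 1 ⌊R⌋₊ := by
  intro e he
  rw [rBox, Fintype.mem_piFinset] at he
  rw [Fintype.mem_piFinset]
  intro i
  have h := Finset.mem_Ico.1 (he i)
  have hc := Nat.ceil_le_floor_add_one R
  exact Finset.mem_Icc.2 ⟨h.1, by omega⟩

/-- **Re-indexing to `1 ≤ eᵢ ≤ ⌊R⌋`**: since `G = 0` on `[1, ∞)`, the tuples with some `eᵢ ≥ R` contribute nothing, so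
the `r`-fold sum over the box `∏ Icc 1 ⌊R⌋₊` (the convention of `FGKMT2018.dkBox`) equals `rFoldSum` (`R > 1`).
[cite: Maynard2016DenseClusters, Lemma 8.4 («G supported on [0,1]», the sum over all e ∈ ℕ^r)] -/
theorem sum_piFinset_Icc_eq_rFoldSum (r : ℕ) (W : Fin r → ℕ) (A : ℕ → ℝ) (Φ : ℝ → ℝ) {G : ℝ → ℝ}
    (hG1 : ∀ t, 1 ≤ t → G t = 0) {R : ℝ} (hR : 1 < R) (c : ℝ) :
    ∑ e ∈ Fintype.piFinset (fun _ : Fin r => Finset.Icc 1 ⌊R⌋₊),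
        rWeight r W A e * (Φ (c + ∑ i, uOf R (e i)) * ∏ i, G (uOf R (e i))) =
      rFoldSum r W A Φ G R c := by
  unfold rFoldSum
  refine (Finset.sum_subset (rBox_subset_piFinset_Icc r R) fun e he hne => ?_).symm
  -- some coordinate has `e i ≥ ⌈R⌉₊ ≥ R`, where `G(u_i) = 0`
  rw [rBox, Fintype.mem_piFinset] at hne
  rw [Fintype.mem_piFinset] at he
  obtain ⟨i, hi⟩ : ∃ i, e i ∉ Finset.Ico 1 ⌈R⌉₊ := by
    by_contra h
    push Not at h
    exact hne h
  have hei := Finset.mem_Icc.1 (he i)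
  have hge : ⌈R⌉₊ ≤ e i := by
    by_contra h
    exact hi (Finset.mem_Ico.2 ⟨hei.1, not_le.1 h⟩)
  have hRe : R ≤ (e i : ℝ) := (Nat.le_ceil R).trans (by exact_mod_cast hge)
  have hlogR : 0 < Real.log R := Real.log_pos hR
  have hu : 1 ≤ uOf R (e i) := by
    rw [uOf, le_div_iff₀ hlogR, one_mul]
    exact Real.log_le_log (by linarith) hRe
  rw [Finset.prod_eq_zero (Finset.mem_univ i) (hG1 _ hu), mul_zero, mul_zero]

end MaynardDense

end Literature.NumberTheory.Sieve
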